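import Literature.Computability.Complexity.NumProgramsPoly
import HarnessLib

/-!
# Numeric register programs, V: the subproduct tree

Literature / complexity toolkit, continuing `NumProgramsPoly.lean` (plain products `pmulP`
through the multiplier opcode, `mulCoeffs`, `coeffList`).  Harvey's factoring algorithm uses
the *product tree* twice (Harvey 2021, Lemma 2.3 = arXiv Lemma 4: `(x - v₁)⋯(x - vₙ)` in
`O(n lg³ N)`; and inside the multipoint evaluation of Proposition 2.5).  This file:

* the tree as data: `leafBlock N v = [(-v) mod N, 1]`, the block `treeBlock N vals j i` of
  level `j` and index `i` (the coefficient vector of length `2^j + 1` of the node polynomial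
  `nodePoly` of the `i`-th run of `2^j` roots; **`listPoly_treeBlock`**, reduced entries), the
  product rule **`mulCoeffs_treeBlock`** (two consecutive blocks of level `j` multiply to the
  block of level `j+1`), and runs of blocks `blocksFrom` (the contents of the level queues);
* the program `ptreeP` (pad the values with zeros to a power of two `P = 2^K`, build the
  levels bottom-up with `pmulP`, keeping every level: the queue `tree` ends with the levels
  `K, K-1, …, 0` in this order, each as its blocks in order — the layout the remainder tree
  descends along), **`ptreeP_spec`** and **`ptreeP_extOK`**;
* cost: `steps ≤ c · (K + 1) · P + Σ_{j<K} 2^{K-1-j} · cost (2^{j+3})` (`treeCost`), i.e.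
  `O(P lg P)` ring operations plus `lg P` batches of multiplications of total length `O(P)`
  each — Harvey's `O(n lg³ N)` once `cost` is quasi-linear.

## References

* D. Harvey, *An exponent one-fifth algorithm for deterministic integer factorisation*, Math.
  Comp. 90 (2021), Lemma 2.3 (arXiv Lemma 4: the product tree) [Harvey2021].
* J. von zur Gathen, J. Gerhard, *Modern Computer Algebra*, 3rd ed., CUP 2013, §10.1,
  Algorithm 10.3 (building the subproduct tree), Lemma 10.4 (its cost) [GathenGerhard2013].
-/

namespace Literature.Computability.Complexity

open _root_.Computability Polynomial

/-! ### The tree as data -/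

section TreeData

variable (N : ℕ)

/-- The leaf of a root `v < N`: the coefficient vector `[(-v) mod N, 1]` of `X - v`.
[von zur Gathen–Gerhard 2013, §10.1] [folklore] -/
def leafBlock (v : ℕ) : List ℕ := [(N - v) % N, 1]

/-- The node polynomial of a list of roots: `∏ (X - v)`. [folklore] -/
noncomputable def nodePoly : List ℕ → (ZMod N)[X]
  | [] => 1
  | v :: ws => (X - C (v : ZMod N)) * nodePoly ws

/-- `nodePoly` of no roots. [folklore] -/
@[simp] theorem nodePoly_nil : nodePoly N [] = 1 := rfl

/-- `nodePoly` of a first root. [folklore] -/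
@[simp] theorem nodePoly_cons (v : ℕ) (ws : List ℕ) : nodePoly N (v :: ws) = (X - C (v : ZMod N)) * nodePoly N ws := rfl

/-- The node polynomial is monic. [folklore] -/
theorem monic_nodePoly : ∀ (ws : List ℕ), (nodePoly N ws).Monic
  | [] => Polynomial.monic_one
  | _ :: ws => (Polynomial.monic_X_sub_C _).mul (monic_nodePoly ws)

/-- The degree of the node polynomial (`1 < N`). [folklore] -/
theorem natDegree_nodePoly (hN : 1 < N) : ∀ (ws : List ℕ), (nodePoly N ws).natDegree = ws.length
  | [] => by simp
  | v :: ws => by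
    haveI : Fact (1 < N) := ⟨hN⟩
    rw [nodePoly_cons, (Polynomial.monic_X_sub_C _).natDegree_mul (monic_nodePoly N ws), natDegree_nodePoly hN ws,
      Polynomial.natDegree_X_sub_C, List.length_cons, Nat.add_comm]

/-- Node polynomials multiply along concatenation. [folklore] -/
theorem nodePoly_append (u w : List ℕ) : nodePoly N (u ++ w) = nodePoly N u * nodePoly N w := by
  induction u with
  | nil => simp
  | cons v u ih => rw [List.cons_append, nodePoly_cons, nodePoly_cons, ih, mul_assoc]

/-- The block of level `j`, index `i`: the coefficient vector of length `2^j + 1` of the node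
polynomial of the `i`-th run of `2^j` roots. [folklore] -/
noncomputable def treeBlock (vals : List ℕ) (j i : ℕ) : List ℕ :=
  coeffList N (2 ^ j + 1) (nodePoly N ((vals.drop (i * 2 ^ j)).take (2 ^ j)))

variable {N}

/-- The leaf codes `X - v` (`v < N`, `1 < N`). [folklore] -/
theorem listPoly_leafBlock {v : ℕ} (hv : v < N) : listPoly N (leafBlock N v) = X - C (v : ZMod N) := by
  have hcast : (((N - v) % N : ℕ) : ZMod N) = -(v : ZMod N) := by
    rw [ZMod.natCast_mod, Nat.cast_sub hv.le, ZMod.natCast_self, zero_sub]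
  simp only [leafBlock, listPoly_cons, listPoly_nil, mul_zero, add_zero, hcast, Nat.cast_one, map_one, mul_one, map_neg]
  ring

/-- The leaf is the block of level `0`. [folklore] -/
theorem leafBlock_eq_treeBlock (hN : 1 < N) {vals : List ℕ} (hv : ∀ v ∈ vals, v < N) {i : ℕ} (hi : i < vals.length) :
    leafBlock N (vals[i]) = treeBlock N vals 0 i := by
  have hlen : (leafBlock N vals[i]).length = 2 ^ 0 + 1 := rfl
  have hred : ∀ a ∈ leafBlock N vals[i], a < N := by
    intro a ha; simp only [leafBlock, List.mem_cons, List.not_mem_nil, or_false] at ha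
    rcases ha with rfl | rfl; exacts [Nat.mod_lt _ (by omega), hN]
  unfold treeBlock
  apply listPoly_injective (N := N) (by rw [hlen, length_coeffList]) hred (fun b hb => lt_of_mem_coeffList hN hb)
  rw [listPoly_leafBlock (hv _ (List.getElem_mem hi)), listPoly_coeffList hN]
  · rw [pow_zero, Nat.mul_one, List.take_one_drop_eq_of_lt_length hi]
    simp
  · rw [pow_zero, Nat.mul_one, List.take_one_drop_eq_of_lt_length hi]
    simp only [nodePoly_cons, nodePoly_nil, mul_one]
    exact (Polynomial.degree_X_sub_C_le _).trans_lt (by exact_mod_cast Nat.lt_succ_self 1)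

/-- Two consecutive blocks of level `j` multiply to the block of level `j + 1` (`1 < N`; beyond
the end of the values the runs are shorter and the identity still holds). [von zur Gathen–Gerhard 2013,
§10.1] [folklore] -/
theorem mulCoeffs_treeBlock (hN : 1 < N) (vals : List ℕ) (j i : ℕ) :
    mulCoeffs N (treeBlock N vals j (2 * i)) (treeBlock N vals j (2 * i + 1)) = treeBlock N vals (j + 1) i := by
  haveI : Fact (1 < N) := ⟨hN⟩
  have hdeg : ∀ m k, (nodePoly N ((vals.drop m).take k)).degree < (k + 1 : ℕ) := by
    intro m k
    rw [Polynomial.degree_eq_natDegree (monic_nodePoly N _).ne_zero, natDegree_nodePoly N hN, Nat.cast_lt, List.length_take]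
    omega
  unfold treeBlock
  have hl : (mulCoeffs N (coeffList N (2 ^ j + 1) (nodePoly N (List.take (2 ^ j) (List.drop (2 * i * 2 ^ j) vals))))
      (coeffList N (2 ^ j + 1) (nodePoly N (List.take (2 ^ j) (List.drop ((2 * i + 1) * 2 ^ j) vals))))).length =
      2 ^ (j + 1) + 1 := by
    rw [length_mulCoeffs, length_coeffList, length_coeffList, pow_succ]; omega
  apply listPoly_injective (N := N) (by rw [hl, length_coeffList]) (fun a ha => lt_of_mem_mulCoeffs hN ha)
    (fun b hb => lt_of_mem_coeffList hN hb)
  rw [listPoly_mulCoeffs hN (by rw [length_coeffList]; omega) (by rw [length_coeffList]; omega),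
    listPoly_coeffList hN (hdeg _ _), listPoly_coeffList hN (hdeg _ _), listPoly_coeffList hN (hdeg _ _), ← nodePoly_append]
  congr 1
  rw [show i * 2 ^ (j + 1) = 2 * i * 2 ^ j by ring, show (2 ^ (j + 1) : ℕ) = 2 ^ j + 2 ^ j by ring, List.take_add,
    List.drop_drop, show 2 * i * 2 ^ j + 2 ^ j = (2 * i + 1) * 2 ^ j by ring]

/-- Length of a block. [folklore] -/
@[simp] theorem length_treeBlock (vals : List ℕ) (j i : ℕ) : (treeBlock N vals j i).length = 2 ^ j + 1 :=
  length_coeffList _ _ _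

/-- Entries of a block are reduced. [folklore] -/
theorem lt_of_mem_treeBlock (hN : 1 < N) {vals : List ℕ} {j i a : ℕ} (ha : a ∈ treeBlock N vals j i) : a < N :=
  lt_of_mem_coeffList hN ha

/-- A block codes its node polynomial (`1 < N`). [folklore] -/
theorem listPoly_treeBlock (hN : 1 < N) (vals : List ℕ) (j i : ℕ) :
    listPoly N (treeBlock N vals j i) = nodePoly N ((vals.drop (i * 2 ^ j)).take (2 ^ j)) := by
  haveI : Fact (1 < N) := ⟨hN⟩
  unfold treeBlock
  refine listPoly_coeffList hN ?_
  rw [Polynomial.degree_eq_natDegree (monic_nodePoly N _).ne_zero, natDegree_nodePoly N hN, Nat.cast_lt, List.length_take]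
  omega

variable (N)

/-- The blocks `a, a+1, …, a+c-1` of level `j`, concatenated: the contents of a level queue.
[folklore] -/
noncomputable def blocksFrom (vals : List ℕ) (j a c : ℕ) : List ℕ := ((List.range' a c).map (treeBlock N vals j)).flatten

variable {N}

/-- No blocks. [folklore] -/
@[simp] theorem blocksFrom_zero (vals : List ℕ) (j a : ℕ) : blocksFrom N vals j a 0 = [] := rfl

/-- The first block in front. [folklore] -/
theorem blocksFrom_succ (vals : List ℕ) (j a c : ℕ) :
    blocksFrom N vals j a (c + 1) = treeBlock N vals j a ++ blocksFrom N vals j (a + 1) c := by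
  simp [blocksFrom, List.range'_succ]

/-- One more block at the end. [folklore] -/
theorem blocksFrom_concat (vals : List ℕ) (j a c : ℕ) :
    blocksFrom N vals j a (c + 1) = blocksFrom N vals j a c ++ treeBlock N vals j (a + c) := by
  simp [blocksFrom, List.range'_concat]

/-- Consecutive runs concatenate. [folklore] -/
theorem blocksFrom_append (vals : List ℕ) (j a c c' : ℕ) :
    blocksFrom N vals j a c ++ blocksFrom N vals j (a + c) c' = blocksFrom N vals j a (c + c') := by
  induction c' with
  | zero => simp
  | succ c' ih => rw [← Nat.add_assoc, blocksFrom_concat, blocksFrom_concat, ← ih, List.append_assoc, Nat.add_assoc]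

/-- Length of a run of blocks. [folklore] -/
theorem length_blocksFrom (vals : List ℕ) (j a c : ℕ) : (blocksFrom N vals j a c).length = c * (2 ^ j + 1) := by
  induction c generalizing a with
  | zero => simp
  | succ c ih => rw [blocksFrom_succ, List.length_append, length_treeBlock, ih, Nat.succ_mul]; omega

/-- Entries of a run of blocks are reduced. [folklore] -/
theorem lt_of_mem_blocksFrom (hN : 1 < N) {vals : List ℕ} {j a c x : ℕ} (hx : x ∈ blocksFrom N vals j a c) : x < N := by
  simp only [blocksFrom, List.mem_flatten, List.mem_map, List.mem_range'] at hx
  obtain ⟨l, ⟨i, -, rfl⟩, hx⟩ := hx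
  exact lt_of_mem_treeBlock hN hx

/-- Reading the first block off a run. [folklore] -/
theorem take_blocksFrom_succ (vals : List ℕ) (j a c : ℕ) :
    (blocksFrom N vals j a (c + 1)).take (2 ^ j + 1) = treeBlock N vals j a := by
  rw [blocksFrom_succ, List.take_append_of_le_length (by simp), List.take_of_length_le (by simp)]

/-- Dropping the first block off a run. [folklore] -/
theorem drop_blocksFrom_succ (vals : List ℕ) (j a c : ℕ) :
    (blocksFrom N vals j a (c + 1)).drop (2 ^ j + 1) = blocksFrom N vals j (a + 1) c := by
  rw [blocksFrom_succ, List.drop_append_of_le_length (by simp), List.drop_of_length_le (by simp), List.nil_append]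

/-- The leaves of reduced values form the run of level `0`. [folklore] -/
theorem leaves_eq_blocksFrom (hN : 1 < N) {vals : List ℕ} (hv : ∀ v ∈ vals, v < N) :
    ∀ {c : ℕ}, c ≤ vals.length → ((vals.take c).map (leafBlock N)).flatten = blocksFrom N vals 0 0 c
  | 0, _ => by simp
  | c + 1, hc => by
    rw [List.take_succ_eq_append_getElem (by omega), List.map_append, List.flatten_append,
      leaves_eq_blocksFrom hN hv (Nat.le_of_succ_le hc), blocksFrom_concat, Nat.zero_add, ← leafBlock_eq_treeBlock hN hv (by omega)]
    simp

variable (N)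

/-- The tree queue after `d` levels have been stored: level `d - 1` on top of level `d - 2` …
on top of level `0` (level `j` has `2^{K-j}` blocks); with `d = K + 1` this is the whole tree,
root first. [folklore] -/
noncomputable def treeAcc (vals : List ℕ) (K : ℕ) : ℕ → List ℕ
  | 0 => []
  | d + 1 => blocksFrom N vals d 0 (2 ^ (K - d)) ++ treeAcc vals K d

variable {N}

/-- Entries of the stored tree are reduced. [folklore] -/
theorem lt_of_mem_treeAcc (hN : 1 < N) (vals : List ℕ) (K : ℕ) : ∀ {d x : ℕ}, x ∈ treeAcc N vals K d → x < N
  | 0, _, h => by simp [treeAcc] at h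
  | d + 1, x, h => by
    rw [treeAcc, List.mem_append] at h
    rcases h with h | h
    exacts [lt_of_mem_blocksFrom hN h, lt_of_mem_treeAcc hN vals K h]

/-- Length of the stored tree: `Σ_{j<d} 2^{K-j} (2^j + 1)`. [folklore] -/
theorem length_treeAcc_le (vals : List ℕ) {K : ℕ} : ∀ {d : ℕ}, d ≤ K + 1 → (treeAcc N vals K d).length ≤ d * 2 ^ (K + 1)
  | 0, _ => by simp [treeAcc]
  | d + 1, hd => by
    rw [treeAcc, List.length_append, length_blocksFrom, Nat.succ_mul]
    have ih := length_treeAcc_le vals (K := K) (d := d) (by omega)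
    have h1 : 2 ^ (K - d) * (2 ^ d + 1) ≤ 2 ^ (K + 1) := by
      have e : 2 ^ (K - d) * 2 ^ d = 2 ^ K := by rw [← pow_add, Nat.sub_add_cancel (by omega)]
      have := Nat.pow_le_pow_right (show 0 < 2 by norm_num) (show K - d ≤ K by omega)
      calc 2 ^ (K - d) * (2 ^ d + 1) = 2 ^ K + 2 ^ (K - d) := by rw [Nat.mul_add, Nat.mul_one, e]
        _ ≤ 2 ^ K + 2 ^ K := by omega
        _ = 2 ^ (K + 1) := by rw [pow_succ]; ring
    omega

end TreeData

namespace NCom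

variable {S V O X E : Type} [DecidableEq S] [DecidableEq V] [DecidableEq O]

/-! ### The product-tree program -/

/-- Scalar roles of `ptreeP`: those of `pmulP`, the number of values `nv`, the padded count
`P = 2^K` and `K`, a loop count `t`, scratch `y, y2, q`, the block length `bl`, the block count
`cnt` and its half, the constants `two, one, zero`, the product length `s2`. [folklore] -/
inductive PTreeS where
  | pm (r : PMulS) | nv | P | K | t | y | y2 | q | bl | cnt | half | two | one | zero | s2
  deriving DecidableEq

/-- Queue roles of `ptreeP`: those of `pmulP`, the values, the current level, the tree.
[folklore] -/
inductive PTreeV where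
  | pv (r : PMulV) | vals | lvl | tree
  deriving DecidableEq

/-- Accumulator roles of `ptreeP`: the one of `pmulP`, the next level, the tree copy.
[folklore] -/
inductive PTreeO where
  | acc | accN | accT
  deriving DecidableEq

section PTree

variable {𝓔 : NExt S V O X E} (M : Multiplier 𝓔) (ρ : PTreeS ↪ S) (ν : PTreeV ↪ V) (ω : PTreeO ↪ O)

/-- The scalar roles of the inner multiplication. [folklore] -/
def PTreeS.pmE : PMulS ↪ PTreeS := ⟨PTreeS.pm, fun _ _ h => PTreeS.pm.inj h⟩

/-- The queue roles of the inner multiplication. [folklore] -/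
def PTreeV.pvE : PMulV ↪ PTreeV := ⟨PTreeV.pv, fun _ _ h => PTreeV.pv.inj h⟩

/-- Scalar roles of the inner `pmulP` inside the outer bank. -/
local notation "ρp" => (PTreeS.pmE.trans ρ)
/-- Queue roles of the inner `pmulP` inside the outer bank. -/
local notation "νp" => (PTreeV.pvE.trans ν)

/-- One pair of blocks: copy both to the tree accumulator while loading them as operands,
multiply, append the product to the next level. [von zur Gathen–Gerhard 2013, Algorithm 10.3]
[folklore] -/
def levelBody : NCom S V O E :=
  teeN (ν .lvl) (ω .acc) (ω .accT) (ρ (.pm .x)) (ρ .bl) ;ₙ pour (ω .acc) (ν (.pv .A)) ;ₙ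
  teeN (ν .lvl) (ω .acc) (ω .accT) (ρ (.pm .x)) (ρ .bl) ;ₙ pour (ω .acc) (ν (.pv .B)) ;ₙ
  mov (ρ (.pm .la)) (ρ .bl) ;ₙ mov (ρ (.pm .lb)) (ρ .bl) ;ₙ
  (pmulP M ρp νp (ω .acc) ;ₙ moveN (ν (.pv .C)) (ω .accN) (ρ (.pm .x)) (ρ .s2))

/-- One level: `half := cnt / 2`, `s2 := 2 bl - 1`, `half` pairs, store the level on the
tree, the products become the current level, `bl := s2`, `cnt := half`. [folklore] -/
def levelP : NCom S V O E :=
  divmod (ρ .half) (ρ .q) (ρ .cnt) (ρ .two) ;ₙ add (ρ .s2) (ρ .bl) (ρ .bl) ;ₙ sub (ρ .s2) (ρ .s2) (ρ .one) ;ₙ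
  times (ρ .half) (levelBody M ρ ν ω) ;ₙ
  pour (ω .accT) (ν .tree) ;ₙ pour (ω .accN) (ν .lvl) ;ₙ mov (ρ .bl) (ρ .s2) ;ₙ mov (ρ .cnt) (ρ .half)

/-- The leaves: for each (padded) value `v`, the block `[(N - v) mod N, 1]` to the level
accumulator. [folklore] -/
def leafBody : NCom S V O E :=
  pop (ν .vals) (ρ (.pm .x)) ;ₙ sub (ρ .y) (ρ (.pm .n)) (ρ (.pm .x)) ;ₙ divmod (ρ .q) (ρ .y2) (ρ .y) (ρ (.pm .n)) ;ₙ
  emit (ω .accN) (ρ .y2) ;ₙ emit (ω .accN) (ρ .one)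

/-- The preparation of the tree: constants, the padded count `P = 2^K`, the padded values,
the leaves as the current level, `bl = 2`, `cnt = P`, `K`. [folklore] -/
def ptreePre : NCom S V O E :=
  setc (ρ .one) 1 ;ₙ setc (ρ .zero) 0 ;ₙ setc (ρ .two) 2 ;ₙ
  pow2P (ρ .P) (ρ .nv) (ρ .t) ;ₙ
  moveN (ν .vals) (ω .acc) (ρ (.pm .x)) (ρ .nv) ;ₙ sub (ρ .cnt) (ρ .P) (ρ .nv) ;ₙ emitK (ω .acc) (ρ .zero) (ρ .cnt) ;ₙ
  pour (ω .acc) (ν .vals) ;ₙ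
  times (ρ .P) (leafBody ρ ν ω) ;ₙ pour (ω .accN) (ν .lvl) ;ₙ
  setc (ρ .bl) 2 ;ₙ mov (ρ .cnt) (ρ .P) ;ₙ sizeOf (ρ .K) (ρ .P) ;ₙ sub (ρ .K) (ρ .K) (ρ .one)

/-- **The subproduct tree** of the values in `vals` (padded with zeros to `P = 2^K` values):
afterwards `tree` holds all levels, root first (`treeAcc N vals' K (K+1)`): the preparation
`ptreePre` (constants, `P`, padding, leaves, `bl = 2`, `cnt = P`, `K`), the `K` levels, and
the root moved in front of the tree. [Harvey 2021, Lemma 2.3; von zur Gathen–Gerhard 2013,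
Algorithm 10.3] [folklore] -/
def ptreeP : NCom S V O E :=
  ptreePre ρ ν ω ;ₙ (times (ρ .K) (levelP M ρ ν ω) ;ₙ (moveN (ν .lvl) (ω .accT) (ρ (.pm .x)) (ρ .bl) ;ₙ pour (ω .accT) (ν .tree)))

/-- The invariant part of the state during the level loops: the modulus, the constants, empty
scratch queues of the multiplier and an empty transfer accumulator. [folklore] -/
structure LevelInv (σ : NState S V O) : Prop where
  hN : 1 < σ.sc (ρ (.pm .n))
  hodd : Odd (σ.sc (ρ (.pm .n)))
  hone : σ.sc (ρ .one) = 1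
  hF : σ.vi (ν (.pv .F)) = []
  hG : σ.vi (ν (.pv .G)) = []
  hH : σ.vi (ν (.pv .H)) = []
  hC : σ.vi (ν (.pv .C)) = []
  hA : σ.vi (ν (.pv .A)) = []
  hB : σ.vi (ν (.pv .B)) = []
  hacc : σ.vo (ω .acc) = []

/-- **One pair of blocks.**  From a state holding in `lvl` the blocks `a, …, a + c - 1` of
level `j` (`c ≥ 2`, `a` even), with `bl = 2^j + 1`, `s2 = 2 bl - 1`: the two front blocks move
to the tree accumulator and their product, the block `a / 2` of level `j + 1`, to the
next-level accumulator. [von zur Gathen–Gerhard 2013, Algorithm 10.3] [folklore] -/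
theorem levelBody_spec {vals : List ℕ} {j a c : ℕ} (σ : NState S V O) (hI : LevelInv ρ ν ω σ)
    (hlvl : σ.vi (ν .lvl) = blocksFrom (σ.sc (ρ (.pm .n))) vals j (2 * a) (c + 2))
    (hbl : σ.sc (ρ .bl) = 2 ^ j + 1) (hs2 : σ.sc (ρ .s2) = 2 ^ (j + 1) + 1) :
    let τ := (levelBody M ρ ν ω : NCom S V O E).eval 𝓔 σ
    LevelInv ρ ν ω τ ∧
      τ.vi (ν .lvl) = blocksFrom (σ.sc (ρ (.pm .n))) vals j (2 * a + 2) c ∧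
      τ.vo (ω .accT) = σ.vo (ω .accT) ++ blocksFrom (σ.sc (ρ (.pm .n))) vals j (2 * a) 2 ∧
      τ.vo (ω .accN) = σ.vo (ω .accN) ++ treeBlock (σ.sc (ρ (.pm .n))) vals (j + 1) a ∧
      τ.vi (ν .vals) = σ.vi (ν .vals) ∧ τ.vi (ν .tree) = σ.vi (ν .tree) ∧ (∀ w, (∀ i, w ≠ ν i) → τ.vi w = σ.vi w) ∧
      (∀ p, (∀ i, p ≠ ω i) → τ.vo p = σ.vo p) ∧
      τ.sc (ρ .bl) = σ.sc (ρ .bl) ∧ τ.sc (ρ .s2) = σ.sc (ρ .s2) ∧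
      (∀ r, (∀ i, r ≠ ρ i) → τ.sc r = σ.sc r) ∧
      (∀ r : PTreeS, (∀ i, r ≠ .pm i) → τ.sc (ρ r) = σ.sc (ρ r)) ∧
      τ.sc (ρ (.pm .n)) = σ.sc (ρ (.pm .n)) ∧
      τ.peak ≤ max σ.peak (max (σ.sc (ρ (.pm .n))) (2 ^ (j + 3))) ∧
      τ.steps ≤ σ.steps + 40 * 2 ^ (j + 1) + M.cost (2 ^ (j + 3)) + 200 ∧
      (levelBody M ρ ν ω : NCom S V O E).extOK 𝓔 σ := by
  intro τ
  obtain ⟨hN, hodd, hone, hF, hG, hH, hC, hA, hB, hacc⟩ := hI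
  set N := σ.sc (ρ (.pm .n)) with hNdef
  have ho : ω .acc ≠ ω .accT := by simp
  have hlen : (σ.vi (ν .lvl)).length = (c + 2) * (2 ^ j + 1) := by rw [hlvl, length_blocksFrom]
  -- the loading prefix
  set X := ((teeN (ν .lvl) (ω .acc) (ω .accT) (ρ (.pm .x)) (ρ .bl) ;ₙ pour (ω .acc) (ν (.pv .A)) ;ₙ
    teeN (ν .lvl) (ω .acc) (ω .accT) (ρ (.pm .x)) (ρ .bl) ;ₙ pour (ω .acc) (ν (.pv .B)) ;ₙ
    mov (ρ (.pm .la)) (ρ .bl) ;ₙ mov (ρ (.pm .lb)) (ρ .bl) : NCom S V O E)).eval 𝓔 σ with hX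
  have hτ : τ = ((pmulP M ρp νp (ω .acc) ;ₙ moveN (ν (.pv .C)) (ω .accN) (ρ (.pm .x)) (ρ .s2) : NCom S V O E)).eval 𝓔 X := by
    simp only [hX, eval_seq]; rfl
  have htake1 : (σ.vi (ν .lvl)).take (σ.sc (ρ .bl)) = treeBlock N vals j (2 * a) := by
    rw [hbl, hlvl, show c + 2 = (c + 1) + 1 by rfl, take_blocksFrom_succ]
  have hdrop1 : (σ.vi (ν .lvl)).drop (σ.sc (ρ .bl)) = blocksFrom N vals j (2 * a + 1) (c + 1) := by
    rw [hbl, hlvl, show c + 2 = (c + 1) + 1 by rfl, drop_blocksFrom_succ]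
  have htake2 : ((σ.vi (ν .lvl)).drop (σ.sc (ρ .bl))).take (σ.sc (ρ .bl)) = treeBlock N vals j (2 * a + 1) := by
    rw [hdrop1, hbl, take_blocksFrom_succ]
  have hdrop2 : ((σ.vi (ν .lvl)).drop (σ.sc (ρ .bl))).drop (σ.sc (ρ .bl)) = blocksFrom N vals j (2 * a + 2) c := by
    rw [hdrop1, hbl, drop_blocksFrom_succ]
  have hXf : X.vi (ν (.pv .A)) = treeBlock N vals j (2 * a) ∧ X.vi (ν (.pv .B)) = treeBlock N vals j (2 * a + 1) ∧
      X.vi (ν .lvl) = blocksFrom N vals j (2 * a + 2) c ∧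
      X.vo (ω .accT) = σ.vo (ω .accT) ++ blocksFrom N vals j (2 * a) 2 ∧ X.vo (ω .acc) = [] ∧ X.vo (ω .accN) = σ.vo (ω .accN) ∧
      (∀ p, (∀ i, p ≠ ω i) → X.vo p = σ.vo p) ∧ X.vi (ν .vals) = σ.vi (ν .vals) ∧ X.vi (ν .tree) = σ.vi (ν .tree) ∧
      (∀ w, (∀ i, w ≠ ν i) → X.vi w = σ.vi w) ∧ X.vi (ν (.pv .F)) = [] ∧ X.vi (ν (.pv .G)) = [] ∧ X.vi (ν (.pv .H)) = [] ∧
      X.vi (ν (.pv .C)) = [] ∧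
      X.sc (ρ (.pm .la)) = 2 ^ j + 1 ∧ X.sc (ρ (.pm .lb)) = 2 ^ j + 1 ∧ X.sc (ρ (.pm .n)) = N ∧
      (∀ r : PTreeS, (∀ i, r ≠ .pm i) → X.sc (ρ r) = σ.sc (ρ r)) ∧ (∀ r, (∀ i, r ≠ ρ i) → X.sc r = σ.sc r) ∧
      X.peak = σ.peak ∧ X.steps = σ.steps + 10 * (2 ^ j + 1) + 6 := by
    simp only [hX, eval_seq]
    rw [teeN_eq 𝓔 (ν .lvl) ho (ρ (.pm .x)) (ρ .bl) σ (by rw [hlen, hbl]; nlinarith)]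
    rw [teeN_eq 𝓔 (ν .lvl) ho (ρ (.pm .x)) (ρ .bl)]
    swap
    · have e : (c + 2) * (2 ^ j + 1) - (2 ^ j + 1) = (c + 1) * (2 ^ j + 1) := by
        rw [show c + 2 = (c + 1) + 1 from rfl, Nat.succ_mul, Nat.add_sub_cancel]
      simp only [eval, NState.sc_bump, NState.sc_setVi, NState.sc_setVo, NState.vi_bump, NState.vi_setVi, NState.vi_setVo]
      rw [Function.update_of_ne (by simp), Function.update_of_ne (by simp), Function.update_self, List.length_drop, hlen, hbl, e]
      exact Nat.le_mul_of_pos_left _ (Nat.succ_pos c)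
    refine ⟨?_, ?_, ?_, ?_, ?_, ?_, fun p hp => ?_, ?_, ?_, fun w hw => ?_, ?_, ?_, ?_, ?_, ?_, ?_, ?_, fun r hr => ?_,
      fun r hr => ?_, ?_, ?_⟩
    · simp [eval, hacc, htake1, hA]
    · simp [eval, hacc, htake2, hB]
    · simp [eval, hdrop2]
    · simp [eval, htake1, htake2, blocksFrom_succ]
    · simp [eval]
    · simp [eval]
    · simp [eval, hp]
    · simp [eval]
    · simp [eval]
    · simp [eval, hw]
    · simp [eval, hF]
    · simp [eval, hG]
    · simp [eval, hH]
    · simp [eval, hC]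
    · simp [eval, hbl]
    · simp [eval, hbl]
    · simp [eval, hNdef]
    · cases r <;> simp [eval] at hr ⊢
    · simp [eval, hr]
    · simp [eval]
    · simp [eval, hacc, htake1, htake2]; rw [hbl]; ring
  obtain ⟨xA, xB, xlvl, xaccT, xacc, xaccN, xvo, xvals, xtree, xw, xF, xG, xH, xC, xla, xlb, xn, xr, xr', xpk, xst⟩ := hXf
  have hpow : 1 ≤ 2 ^ j := Nat.one_le_two_pow
  -- the multiplication
  obtain ⟨p1, pA, pB, pF, pG, pH, pw, pvo, pn, pla, plb, pr, ppk, pst⟩ :=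
    pmulP_spec (𝓔 := 𝓔) M (PTreeS.pmE.trans ρ) (PTreeV.pvE.trans ν) (ω .acc) X
      (by show 1 < X.sc (ρ (.pm .n)); rw [xn]; exact hN)
      (by show X.sc (ρ (.pm .la)) = (X.vi (ν (.pv .A))).length; rw [xla, xA, length_treeBlock])
      (by show X.sc (ρ (.pm .lb)) = (X.vi (ν (.pv .B))).length; rw [xlb, xB, length_treeBlock])
      (by show 0 < (X.vi (ν (.pv .A))).length; rw [xA, length_treeBlock]; omega)
      (by show 0 < (X.vi (ν (.pv .B))).length; rw [xB, length_treeBlock]; omega)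
      (by show ∀ x ∈ X.vi (ν (.pv .B)), x < X.sc (ρ (.pm .n)); rw [xB, xn]; exact fun x hx => lt_of_mem_treeBlock hN hx)
      xF xG xC xacc
  set Y := (pmulP M (PTreeS.pmE.trans ρ) (PTreeV.pvE.trans ν) (ω .acc) : NCom S V O E).eval 𝓔 X with hY
  change Y.vi (ν (.pv .C)) = mulCoeffs (X.sc (ρ (.pm .n))) (X.vi (ν (.pv .A))) (X.vi (ν (.pv .B))) at p1
  rw [xn, xA, xB, mulCoeffs_treeBlock hN] at p1
  change Y.sc (ρ (.pm .n)) = X.sc (ρ (.pm .n)) at pn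
  have ys2 : Y.sc (ρ .s2) = 2 ^ (j + 1) + 1 := by
    rw [pr (ρ .s2) (fun i => by simp [PTreeS.pmE]), xr .s2 (fun i => by simp), hs2]
  -- the transfer of the product
  obtain ⟨m1, m2, m3, m4, m5, m6, m7⟩ := moveN_spec 𝓔 (ν (.pv .C)) (ω .accN) (ρ (.pm .x)) (ρ .s2) Y
    (by rw [ys2, p1, length_treeBlock])
  have hτ' : τ = (moveN (ν (.pv .C)) (ω .accN) (ρ (.pm .x)) (ρ .s2) : NCom S V O E).eval 𝓔 Y := by rw [hτ]; rfl
  rw [ys2, p1] at m1 m2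
  rw [← length_treeBlock (N := N) vals (j + 1) a, List.drop_length] at m1
  rw [List.take_of_length_le (by rw [length_treeBlock])] at m2
  -- reading registers of `τ`
  have rsc : ∀ r : PTreeS, r ≠ .pm .x → (∀ i, r ≠ .pm i) → τ.sc (ρ r) = σ.sc (ρ r) := by
    intro r hx hr
    rw [hτ', m3 _ (by simpa using hx), pr (ρ r) (fun i => by simpa [PTreeS.pmE] using hr i), xr r hr]
  have rn : τ.sc (ρ (.pm .n)) = N := by rw [hτ', m3 _ (by simp), pn, xn]
  have rvi : ∀ w : PTreeV, w ≠ .pv .C → (∀ i, w ≠ .pv i) → τ.vi (ν w) = X.vi (ν w) := by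
    intro w hc hw
    rw [hτ', m4 _ (by simpa using hc), pw (ν w) (fun i => by simpa [PTreeV.pvE] using hw i)]
  have rvp : ∀ w : PMulV, w ≠ .C → τ.vi (ν (.pv w)) = Y.vi (ν (.pv w)) := fun w hw => by
    rw [hτ', m4 _ (by simpa using hw)]
  have hext : (levelBody M ρ ν ω : NCom S V O E).extOK 𝓔 σ := by
    show ((teeN (ν .lvl) (ω .acc) (ω .accT) (ρ (.pm .x)) (ρ .bl) ;ₙ pour (ω .acc) (ν (.pv .A)) ;ₙ
      teeN (ν .lvl) (ω .acc) (ω .accT) (ρ (.pm .x)) (ρ .bl) ;ₙ pour (ω .acc) (ν (.pv .B)) ;ₙ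
      mov (ρ (.pm .la)) (ρ .bl) ;ₙ mov (ρ (.pm .lb)) (ρ .bl) ;ₙ
      (pmulP M ρp νp (ω .acc) ;ₙ moveN (ν (.pv .C)) (ω .accN) (ρ (.pm .x)) (ρ .s2)) : NCom S V O E)).extOK 𝓔 σ
    simp only [extOK_seq]
    refine ⟨extOK_of_noExt 𝓔 (teeN_noExt _ _ _ _ _) _, trivial, extOK_of_noExt 𝓔 (teeN_noExt _ _ _ _ _) _, trivial, trivial, trivial,
      ?_, extOK_of_noExt 𝓔 (moveN_noExt _ _ _ _) _⟩
    exact pmulP_extOK (𝓔 := 𝓔) M (PTreeS.pmE.trans ρ) (PTreeV.pvE.trans ν) (ω .acc) X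
      (by show 1 < X.sc (ρ (.pm .n)); rw [xn]; exact hN) (by show Odd (X.sc (ρ (.pm .n))); rw [xn]; exact hodd)
      (by show X.sc (ρ (.pm .la)) = (X.vi (ν (.pv .A))).length; rw [xla, xA, length_treeBlock])
      (by show X.sc (ρ (.pm .lb)) = (X.vi (ν (.pv .B))).length; rw [xlb, xB, length_treeBlock])
      (by show 0 < (X.vi (ν (.pv .A))).length; rw [xA, length_treeBlock]; omega)
      (by show 0 < (X.vi (ν (.pv .B))).length; rw [xB, length_treeBlock]; omega)
      (by show ∀ x ∈ X.vi (ν (.pv .A)), x < X.sc (ρ (.pm .n)); rw [xA, xn]; exact fun x hx => lt_of_mem_treeBlock hN hx)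
      (by show ∀ x ∈ X.vi (ν (.pv .B)), x < X.sc (ρ (.pm .n)); rw [xB, xn]; exact fun x hx => lt_of_mem_treeBlock hN hx)
      xF xG xacc
  refine ⟨⟨?_, ?_, ?_, ?_, ?_, ?_, ?_, ?_, ?_, ?_⟩, ?_, ?_, ?_, ?_, ?_, fun w hw => ?_, fun p hp => ?_, ?_, ?_, fun r hr => ?_,
    fun r hr => ?_, rn, ?_, ?_, hext⟩
  · rw [rn]; exact hN
  · rw [rn]; exact hodd
  · rw [rsc .one (by simp) (fun i => by simp), hone]
  · rw [rvp .F (by simp)]; exact pF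
  · rw [rvp .G (by simp)]; exact pG
  · rw [rvp .H (by simp)]; exact pH
  · rw [hτ']; exact m1
  · rw [rvp .A (by simp)]; exact pA
  · rw [rvp .B (by simp)]; exact pB
  · rw [hτ', m5 _ (by simp), pvo, xacc]
  · rw [rvi .lvl (by simp) (fun i => by simp), xlvl]
  · rw [hτ', m5 _ (by simp), pvo, xaccT]
  · rw [hτ', m2, pvo, xaccN]
  · rw [rvi .vals (by simp) (fun i => by simp), xvals]
  · rw [rvi .tree (by simp) (fun i => by simp), xtree]
  · rw [hτ', m4 _ (fun h => hw (.pv .C) h), pw w (fun i => hw (.pv i)), xw w hw]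
  · rw [hτ', m5 _ (fun h => hp .accN h), pvo, xvo p hp]
  · exact rsc .bl (by simp) (fun i => by simp)
  · exact rsc .s2 (by simp) (fun i => by simp)
  · rw [hτ', m3 _ (fun h => hr (.pm .x) h), pr r (fun i => hr (.pm i)), xr' r hr]
  · by_cases hx : r = .pm .x
    · exact absurd hx (hr .x)
    · exact rsc r hx hr
  · rw [hτ', m6]
    refine ppk.trans (max_le (by rw [xpk]; exact le_max_left _ _) (le_max_of_le_right (max_le ?_ ?_)))
    · show X.sc (ρ (.pm .n)) ≤ _; rw [xn]; exact le_max_left _ _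
    · show 2 * (X.sc (ρ (.pm .la)) + X.sc (ρ (.pm .lb))) ≤ _; rw [xla, xlb, pow_succ, pow_succ, pow_succ]; omega
  · have hc : M.cost (2 * (X.sc (ρ (.pm .la)) + X.sc (ρ (.pm .lb)))) ≤ M.cost (2 ^ (j + 3)) :=
      M.cost_mono (by rw [xla, xlb, pow_succ, pow_succ, pow_succ]; omega)
    rw [hτ', m7, ys2]
    change Y.steps ≤ X.steps + 30 * (X.sc (ρ (.pm .la)) + X.sc (ρ (.pm .lb))) + M.cost (2 * (X.sc (ρ (.pm .la)) + X.sc (ρ (.pm .lb)))) + 30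
      at pst
    have := pst.trans (Nat.add_le_add_right (Nat.add_le_add_left hc _) 30)
    rw [xla, xlb, xst] at this
    have e1 : (2 : ℕ) ^ (j + 1) = 2 * 2 ^ j := by rw [pow_succ]; ring
    rw [e1]
    omega

/-- **`i` pairs of blocks** (the inner loop of a level). [folklore] -/
theorem levelBody_iterate {vals : List ℕ} {j a c : ℕ} (σ : NState S V O) (hI : LevelInv ρ ν ω σ)
    (hlvl : σ.vi (ν .lvl) = blocksFrom (σ.sc (ρ (.pm .n))) vals j (2 * a) (2 * c))
    (hbl : σ.sc (ρ .bl) = 2 ^ j + 1) (hs2 : σ.sc (ρ .s2) = 2 ^ (j + 1) + 1) :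
    ∀ i, i ≤ c → let τ := ((levelBody M ρ ν ω : NCom S V O E).eval 𝓔)^[i] σ
      LevelInv ρ ν ω τ ∧
        τ.vi (ν .lvl) = blocksFrom (σ.sc (ρ (.pm .n))) vals j (2 * a + 2 * i) (2 * c - 2 * i) ∧
        τ.vo (ω .accT) = σ.vo (ω .accT) ++ blocksFrom (σ.sc (ρ (.pm .n))) vals j (2 * a) (2 * i) ∧
        τ.vo (ω .accN) = σ.vo (ω .accN) ++ blocksFrom (σ.sc (ρ (.pm .n))) vals (j + 1) a i ∧
        τ.vi (ν .vals) = σ.vi (ν .vals) ∧ τ.vi (ν .tree) = σ.vi (ν .tree) ∧ (∀ w, (∀ i, w ≠ ν i) → τ.vi w = σ.vi w) ∧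
        (∀ p, (∀ i, p ≠ ω i) → τ.vo p = σ.vo p) ∧
        τ.sc (ρ .bl) = σ.sc (ρ .bl) ∧ τ.sc (ρ .s2) = σ.sc (ρ .s2) ∧
        (∀ r, (∀ i, r ≠ ρ i) → τ.sc r = σ.sc r) ∧
        (∀ r : PTreeS, (∀ i, r ≠ .pm i) → τ.sc (ρ r) = σ.sc (ρ r)) ∧
        τ.sc (ρ (.pm .n)) = σ.sc (ρ (.pm .n)) ∧
        τ.peak ≤ max σ.peak (max (σ.sc (ρ (.pm .n))) (2 ^ (j + 3))) ∧
        τ.steps ≤ σ.steps + i * (40 * 2 ^ (j + 1) + M.cost (2 ^ (j + 3)) + 200) ∧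
        (i < c → (levelBody M ρ ν ω : NCom S V O E).extOK 𝓔 τ)
  | 0, hc => ⟨hI, by simpa using hlvl, by simp, by simp, rfl, rfl, fun _ _ => rfl, fun _ _ => rfl, rfl, rfl, fun _ _ => rfl,
      fun _ _ => rfl, rfl, le_max_left _ _, by simp, fun h0 =>
        (levelBody_spec (𝓔 := 𝓔) M ρ ν ω (vals := vals) (j := j) (a := a) (c := 2 * c - 2) σ hI
          (by rw [hlvl]; congr 1; omega) hbl hs2).2.2.2.2.2.2.2.2.2.2.2.2.2.2.2⟩
  | i + 1, hi => by
    obtain ⟨h1, h2, h3, h4, h5, h6, h7, h8, h9, h10, h11, h12, h13, h14, h15, -⟩ := levelBody_iterate σ hI hlvl hbl hs2 i (Nat.le_of_succ_le hi)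
    intro τ
    set υ := ((levelBody M ρ ν ω : NCom S V O E).eval 𝓔)^[i] σ with hυ
    have hτ : τ = (levelBody M ρ ν ω : NCom S V O E).eval 𝓔 υ := Function.iterate_succ_apply' _ _ _
    rw [h13.symm] at h2
    obtain ⟨r1, r2, r3, r4, r5, r6, r7, r8, r9, r10, r11, r12, r13, r14, r15, -⟩ :=
      levelBody_spec (𝓔 := 𝓔) M ρ ν ω (vals := vals) (j := j) (a := a + i) (c := 2 * c - 2 * i - 2) υ h1
        (by rw [h2]; congr 1 <;> omega) (h9.trans hbl) (h10.trans hs2)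
    rw [h13] at r2 r3 r4 r13 r14
    rw [hτ]
    have hnext : i + 1 < c → (levelBody M ρ ν ω : NCom S V O E).extOK 𝓔 ((levelBody M ρ ν ω : NCom S V O E).eval 𝓔 υ) := by
      intro hlt
      have r2' := r2
      rw [← r13] at r2'
      exact (levelBody_spec (𝓔 := 𝓔) M ρ ν ω (vals := vals) (j := j) (a := a + i + 1) (c := 2 * c - 2 * i - 4) _ r1
        (by rw [r2']; congr 1; omega) (r9.trans (h9.trans hbl)) (r10.trans (h10.trans hs2))).2.2.2.2.2.2.2.2.2.2.2.2.2.2.2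
    refine ⟨r1, ?_, ?_, ?_, r5.trans h5, r6.trans h6, fun w hw => (r7 w hw).trans (h7 w hw), fun p hp => (r8 p hp).trans (h8 p hp),
      r9.trans h9, r10.trans h10, fun r hr => (r11 r hr).trans (h11 r hr), fun r hr => (r12 r hr).trans (h12 r hr), r13, ?_, ?_,
      hnext⟩
    · rw [r2]; congr 1; omega
    · rw [r3, h3, List.append_assoc, show 2 * (a + i) = 2 * a + 2 * i by ring, blocksFrom_append, show 2 * i + 2 = 2 * (i + 1) by ring]
    · rw [r4, h4, List.append_assoc, ← blocksFrom_concat]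
    · exact r14.trans (max_le (h14.trans (max_le (le_max_left _ _) (le_max_right _ _))) (le_max_right _ _))
    · rw [Nat.succ_mul]; omega

omit [DecidableEq S] [DecidableEq V] [DecidableEq O] in
/-- `LevelInv` only depends on the registers. [folklore] -/
theorem LevelInv.bump {σ : NState S V O} (h : LevelInv ρ ν ω σ) (a k : ℕ) : LevelInv ρ ν ω (σ.bump a k) :=
  ⟨h.hN, h.hodd, h.hone, h.hF, h.hG, h.hH, h.hC, h.hA, h.hB, h.hacc⟩

/-- **One level of the tree.**  From level `j` with `2 c` blocks in `lvl` (`cnt = 2 c`,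
`bl = 2^j + 1`, `two = 2`, empty level accumulators): level `j` is stored in front of `tree`,
`lvl` becomes level `j + 1` (`c` blocks), `bl := 2^{j+1} + 1`, `cnt := c`.
[von zur Gathen–Gerhard 2013, Algorithm 10.3] [folklore] -/
theorem levelP_spec {vals : List ℕ} {j c : ℕ} (σ : NState S V O) (hI : LevelInv ρ ν ω σ)
    (hlvl : σ.vi (ν .lvl) = blocksFrom (σ.sc (ρ (.pm .n))) vals j 0 (2 * c)) (hcnt : σ.sc (ρ .cnt) = 2 * c)
    (hbl : σ.sc (ρ .bl) = 2 ^ j + 1) (htwo : σ.sc (ρ .two) = 2) (haccT : σ.vo (ω .accT) = []) (haccN : σ.vo (ω .accN) = []) :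
    let τ := (levelP M ρ ν ω : NCom S V O E).eval 𝓔 σ
    LevelInv ρ ν ω τ ∧
      τ.vi (ν .lvl) = blocksFrom (σ.sc (ρ (.pm .n))) vals (j + 1) 0 c ∧
      τ.vi (ν .tree) = blocksFrom (σ.sc (ρ (.pm .n))) vals j 0 (2 * c) ++ σ.vi (ν .tree) ∧
      τ.vo (ω .accT) = [] ∧ τ.vo (ω .accN) = [] ∧
      τ.sc (ρ .bl) = 2 ^ (j + 1) + 1 ∧ τ.sc (ρ .cnt) = c ∧ τ.sc (ρ .two) = 2 ∧
      τ.vi (ν .vals) = σ.vi (ν .vals) ∧ (∀ w, (∀ i, w ≠ ν i) → τ.vi w = σ.vi w) ∧ (∀ p, (∀ i, p ≠ ω i) → τ.vo p = σ.vo p) ∧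
      (∀ r, (∀ i, r ≠ ρ i) → τ.sc r = σ.sc r) ∧
      τ.sc (ρ .K) = σ.sc (ρ .K) ∧ τ.sc (ρ .P) = σ.sc (ρ .P) ∧ τ.sc (ρ .nv) = σ.sc (ρ .nv) ∧ τ.sc (ρ .zero) = σ.sc (ρ .zero) ∧
      τ.sc (ρ (.pm .n)) = σ.sc (ρ (.pm .n)) ∧
      τ.peak ≤ max σ.peak (max (σ.sc (ρ (.pm .n))) (max (2 ^ (j + 3)) (σ.sc (ρ .cnt)))) ∧
      τ.steps ≤ σ.steps + c * (50 * 2 ^ (j + 1) + M.cost (2 ^ (j + 3)) + 210) + 10 ∧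
      (levelP M ρ ν ω : NCom S V O E).extOK 𝓔 σ := by
  intro τ
  obtain ⟨hN, hodd, hone, hF, hG, hH, hC, hA, hB, hacc⟩ := hI
  set N := σ.sc (ρ (.pm .n)) with hNdef
  -- stage 1: `half`, `s2`
  set X₁ := ((sub (ρ .s2) (ρ .s2) (ρ .one) : NCom S V O E)).eval 𝓔 (((add (ρ .s2) (ρ .bl) (ρ .bl) : NCom S V O E)).eval 𝓔
    (((divmod (ρ .half) (ρ .q) (ρ .cnt) (ρ .two) : NCom S V O E)).eval 𝓔 σ)) with hX₁
  have xhalf : X₁.sc (ρ .half) = c := by simp [hX₁, eval, hcnt, htwo]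
  have xs2 : X₁.sc (ρ .s2) = 2 ^ (j + 1) + 1 := by simp [hX₁, eval, hbl, hone, pow_succ]; omega
  have xbl : X₁.sc (ρ .bl) = 2 ^ j + 1 := by simp [hX₁, eval, hbl]
  have xr : ∀ r : PTreeS, r ≠ .half → r ≠ .q → r ≠ .s2 → X₁.sc (ρ r) = σ.sc (ρ r) := fun r h1 h2 h3 => by simp [hX₁, eval, h1, h2, h3]
  have xr' : ∀ r, (∀ i, r ≠ ρ i) → X₁.sc r = σ.sc r := fun r hr => by simp [hX₁, eval, hr]
  have xvi : X₁.vi = σ.vi := by simp [hX₁, eval]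
  have xvo : X₁.vo = σ.vo := by simp [hX₁, eval]
  have xpk : X₁.peak = max σ.peak (2 ^ j + 1 + (2 ^ j + 1)) := by simp [hX₁, eval, hbl]
  have xst : X₁.steps = σ.steps + 3 := by simp [hX₁, eval]
  have xI : LevelInv ρ ν ω X₁ :=
    ⟨by rw [xr _ (by simp) (by simp) (by simp)]; exact hN, by rw [xr _ (by simp) (by simp) (by simp)]; exact hodd,
     by rw [xr _ (by simp) (by simp) (by simp)]; exact hone, by rw [xvi]; exact hF, by rw [xvi]; exact hG, by rw [xvi]; exact hH,
     by rw [xvi]; exact hC, by rw [xvi]; exact hA, by rw [xvi]; exact hB, by rw [xvo]; exact hacc⟩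
  have xn : X₁.sc (ρ (.pm .n)) = N := xr _ (by simp) (by simp) (by simp)
  -- stage 2: the pairs
  set Z := X₁.bump 0 (c + 1) with hZ
  have hiter := levelBody_iterate (𝓔 := 𝓔) M ρ ν ω (vals := vals) (j := j) (a := 0) (c := c) Z (xI.bump _ _ _ 0 (c + 1))
      (by simp only [hZ, NState.vi_bump, NState.sc_bump, xvi, xn, Nat.mul_zero]; exact hlvl) (by simpa [hZ] using xbl)
      (by simpa [hZ] using xs2)
  obtain ⟨i1, i2, i3, i4, i5, i6, i7, i8, i9, i10, i11, i12, i13, i14, i15, -⟩ := hiter c le_rfl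
  set Y := ((levelBody M ρ ν ω : NCom S V O E).eval 𝓔)^[c] Z with hY
  have hτ : τ = ((pour (ω .accT) (ν .tree) ;ₙ pour (ω .accN) (ν .lvl) ;ₙ mov (ρ .bl) (ρ .s2) ;ₙ mov (ρ .cnt) (ρ .half) :
      NCom S V O E)).eval 𝓔 Y := by
    show ((_ ;ₙ _ ;ₙ _ ;ₙ times _ _ ;ₙ _ : NCom S V O E)).eval 𝓔 σ = _
    rw [eval_seq, eval_seq, eval_seq, eval_seq, eval_times, ← hX₁, xhalf]
  simp only [hZ, NState.sc_bump, NState.vi_bump, NState.vo_bump, NState.peak_bump, NState.steps_bump, Nat.max_zero, xn,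
    Nat.mul_zero, Nat.zero_add, Nat.sub_self, xvi, xvo, haccT, haccN, List.nil_append, xbl, xs2, xpk, xst] at i2 i3 i4 i5 i6 i7 i8 i9 i10 i11 i12 i13 i14 i15
  have yn := i13
  have ybl := i9
  have ys2 := i10
  have yhalf : Y.sc (ρ .half) = c := (i12 .half (by simp)).trans xhalf
  have ytwo : Y.sc (ρ .two) = 2 := by rw [i12 .two (by simp), xr _ (by simp) (by simp) (by simp), htwo]
  obtain ⟨yN, yodd, yone, yF, yG, yH, yC, yA, yB, yacc⟩ := i1
  have hext : (levelP M ρ ν ω : NCom S V O E).extOK 𝓔 σ := by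
    show ((divmod (ρ .half) (ρ .q) (ρ .cnt) (ρ .two) ;ₙ add (ρ .s2) (ρ .bl) (ρ .bl) ;ₙ sub (ρ .s2) (ρ .s2) (ρ .one) ;ₙ
      times (ρ .half) (levelBody M ρ ν ω) ;ₙ
      pour (ω .accT) (ν .tree) ;ₙ pour (ω .accN) (ν .lvl) ;ₙ mov (ρ .bl) (ρ .s2) ;ₙ mov (ρ .cnt) (ρ .half) : NCom S V O E)).extOK 𝓔 σ
    simp only [extOK_seq]
    refine ⟨trivial, trivial, trivial, ?_, trivial, trivial, trivial, trivial⟩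
    rw [extOK_times]
    intro i hi
    change i < X₁.sc (ρ .half) at hi
    rw [xhalf] at hi
    have := (hiter i hi.le).2.2.2.2.2.2.2.2.2.2.2.2.2.2.2 hi
    rwa [← hX₁, xhalf]
  refine ⟨⟨?_, ?_, ?_, ?_, ?_, ?_, ?_, ?_, ?_, ?_⟩, ?_, ?_, ?_, ?_, ?_, ?_, ?_, ?_, fun w hw => ?_, fun p hp => ?_, fun r hr => ?_,
    ?_, ?_, ?_, ?_, ?_, ?_, ?_, hext⟩
  · rw [hτ]; simpa [eval] using yN
  · rw [hτ]; simpa [eval] using yodd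
  · rw [hτ]; simpa [eval] using yone
  · rw [hτ]; simpa [eval] using yF
  · rw [hτ]; simpa [eval] using yG
  · rw [hτ]; simpa [eval] using yH
  · rw [hτ]; simpa [eval] using yC
  · rw [hτ]; simpa [eval] using yA
  · rw [hτ]; simpa [eval] using yB
  · rw [hτ]; simpa [eval] using yacc
  · rw [hτ]; simp [eval, i2, i4]
  · rw [hτ]; simp [eval, i3, i6]
  · rw [hτ]; simp [eval]
  · rw [hτ]; simp [eval]
  · rw [hτ]; simp [eval, ys2]
  · rw [hτ]; simp [eval, yhalf]
  · rw [hτ]; simp [eval, ytwo]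
  · rw [hτ]; simp [eval, i5]
  · rw [hτ]; simp [eval, hw, i7 w hw]
  · rw [hτ]; simp [eval, hp, i8 p hp]
  · rw [hτ]; simp [eval, hr, i11 r hr, xr' r hr]
  · rw [hτ]; simp [eval, i12 .K (by simp), xr .K (by simp) (by simp) (by simp)]
  · rw [hτ]; simp [eval, i12 .P (by simp), xr .P (by simp) (by simp) (by simp)]
  · rw [hτ]; simp [eval, i12 .nv (by simp), xr .nv (by simp) (by simp) (by simp)]
  · rw [hτ]; simp [eval, i12 .zero (by simp), xr .zero (by simp) (by simp) (by simp)]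
  · rw [hτ]; simpa [eval] using yn
  · rw [hτ]
    simp only [eval, NState.peak_bump, NState.peak_setVi, NState.peak_setVo, NState.peak_setSc, Nat.max_zero]
    refine i14.trans (max_le (max_le (le_max_left _ _) (le_max_of_le_right (le_max_of_le_right (le_max_of_le_left ?_))))
      (le_max_of_le_right (max_le (le_max_left _ _) (le_max_of_le_right (le_max_left _ _)))))
    have := Nat.one_le_two_pow (n := j)
    rw [pow_succ, pow_succ, pow_succ]; omega
  · rw [hτ]
    simp only [eval, NState.steps_bump, NState.steps_setVi, NState.steps_setVo, NState.steps_setSc, NState.vo_setVi, NState.vo_bump,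
      NState.vo_setVo, i3, length_blocksFrom]
    rw [Function.update_of_ne (by simp), i4, length_blocksFrom]
    have e1 : (2 : ℕ) ^ (j + 1) = 2 * 2 ^ j := by rw [pow_succ]; ring
    rw [e1] at i15 ⊢
    nlinarith [i15, Nat.zero_le (c * 2 ^ j), Nat.zero_le (M.cost (2 ^ (j + 3)))]

/-- The multiplier part of the cost of `d` levels: `Σ_{j<d} 2^{K-1-j} · cost (2^{j+3})`.
[von zur Gathen–Gerhard 2013, Lemma 10.4] [folklore] -/
def treeCostD (cost : ℕ → ℕ) (K : ℕ) : ℕ → ℕ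
  | 0 => 0
  | d + 1 => treeCostD cost K d + 2 ^ (K - 1 - d) * cost (2 ^ (d + 3))

/-- **`d` levels of the tree** (the outer loop). [folklore] -/
theorem levelP_iterate {vals : List ℕ} {K : ℕ} (σ : NState S V O) (hI : LevelInv ρ ν ω σ)
    (hlvl : σ.vi (ν .lvl) = blocksFrom (σ.sc (ρ (.pm .n))) vals 0 0 (2 ^ K)) (hcnt : σ.sc (ρ .cnt) = 2 ^ K)
    (hbl : σ.sc (ρ .bl) = 2) (htwo : σ.sc (ρ .two) = 2) (haccT : σ.vo (ω .accT) = []) (haccN : σ.vo (ω .accN) = [])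
    (htree : σ.vi (ν .tree) = []) :
    ∀ d, d ≤ K → let τ := ((levelP M ρ ν ω : NCom S V O E).eval 𝓔)^[d] σ
      LevelInv ρ ν ω τ ∧
        τ.vi (ν .lvl) = blocksFrom (σ.sc (ρ (.pm .n))) vals d 0 (2 ^ (K - d)) ∧
        τ.vi (ν .tree) = treeAcc (σ.sc (ρ (.pm .n))) vals K d ∧
        τ.vo (ω .accT) = [] ∧ τ.vo (ω .accN) = [] ∧
        τ.sc (ρ .bl) = 2 ^ d + 1 ∧ τ.sc (ρ .cnt) = 2 ^ (K - d) ∧ τ.sc (ρ .two) = 2 ∧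
        τ.vi (ν .vals) = σ.vi (ν .vals) ∧ (∀ w, (∀ i, w ≠ ν i) → τ.vi w = σ.vi w) ∧ (∀ p, (∀ i, p ≠ ω i) → τ.vo p = σ.vo p) ∧
        (∀ r, (∀ i, r ≠ ρ i) → τ.sc r = σ.sc r) ∧
        τ.sc (ρ .K) = σ.sc (ρ .K) ∧ τ.sc (ρ .P) = σ.sc (ρ .P) ∧ τ.sc (ρ .nv) = σ.sc (ρ .nv) ∧ τ.sc (ρ .zero) = σ.sc (ρ .zero) ∧
        τ.sc (ρ (.pm .n)) = σ.sc (ρ (.pm .n)) ∧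
        τ.peak ≤ max σ.peak (max (σ.sc (ρ (.pm .n))) (2 ^ (K + 2))) ∧
        τ.steps ≤ σ.steps + d * (50 * 2 ^ K + 10) + 210 * (2 ^ K - 2 ^ (K - d)) + treeCostD M.cost K d ∧
        (d < K → (levelP M ρ ν ω : NCom S V O E).extOK 𝓔 τ)
  | 0, _ => ⟨hI, by simpa using hlvl, by simp [treeAcc, htree], haccT, haccN, by simpa using hbl, by simpa using hcnt, htwo, rfl,
      fun _ _ => rfl, fun _ _ => rfl, fun _ _ => rfl, rfl, rfl, rfl, rfl, rfl, le_max_left _ _, by simp [treeCostD], fun h0 => by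
        have hc : 2 ^ K = 2 * 2 ^ (K - 1) := by rw [← pow_succ', Nat.sub_add_cancel (by omega)]
        have hl := hlvl; rw [hc] at hl
        have hct := hcnt; rw [hc] at hct
        exact (levelP_spec (𝓔 := 𝓔) M ρ ν ω (vals := vals) (j := 0) (c := 2 ^ (K - 1)) σ hI hl hct hbl htwo haccT haccN).2.2.2.2.2.2.2.2.2.2.2.2.2.2.2.2.2.2.2⟩
  | d + 1, hd => by
    obtain ⟨h1, h2, h3, h4, h5, h6, h7, h8, h9, h10, h11, h12, h13, h14, h15, h16, h17, h18, h19, -⟩ :=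
      levelP_iterate σ hI hlvl hcnt hbl htwo haccT haccN htree d (Nat.le_of_succ_le hd)
    intro τ
    set υ := ((levelP M ρ ν ω : NCom S V O E).eval 𝓔)^[d] σ with hυ
    have hτ : τ = (levelP M ρ ν ω : NCom S V O E).eval 𝓔 υ := Function.iterate_succ_apply' _ _ _
    have hc : 2 ^ (K - d) = 2 * 2 ^ (K - (d + 1)) := by
      rw [← pow_succ', show K - (d + 1) + 1 = K - d by omega]
    rw [← h17, hc] at h2
    rw [hc] at h7
    obtain ⟨r1, r2, r3, r4, r5, r6, r7, r8, r9, r10, r11, r12, r13, r14, r15, r16, r17, r18, r19, -⟩ :=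
      levelP_spec (𝓔 := 𝓔) M ρ ν ω (vals := vals) (j := d) (c := 2 ^ (K - (d + 1))) υ h1 h2 h7 h6 h8 h4 h5
    rw [h17] at r2 r3 r17 r18
    rw [hτ]
    have hnext : d + 1 < K → (levelP M ρ ν ω : NCom S V O E).extOK 𝓔 ((levelP M ρ ν ω : NCom S V O E).eval 𝓔 υ) := by
      intro hlt
      have hc' : 2 ^ (K - (d + 1)) = 2 * 2 ^ (K - (d + 2)) := by
        rw [← pow_succ', show K - (d + 2) + 1 = K - (d + 1) by omega]
      have r2' := r2; rw [← r17, hc'] at r2'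
      have r7' := r7; rw [hc'] at r7'
      exact (levelP_spec (𝓔 := 𝓔) M ρ ν ω (vals := vals) (j := d + 1) (c := 2 ^ (K - (d + 2))) _ r1 r2' r7' r6 r8 r4 r5).2.2.2.2.2.2.2.2.2.2.2.2.2.2.2.2.2.2.2
    refine ⟨r1, r2, ?_, r4, r5, r6, r7, r8, r9.trans h9, fun w hw => (r10 w hw).trans (h10 w hw),
      fun p hp => (r11 p hp).trans (h11 p hp), fun r hr => (r12 r hr).trans (h12 r hr), r13.trans h13, r14.trans h14,
      r15.trans h15, r16.trans h16, r17, ?_, ?_, hnext⟩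
    · rw [r3, h3, treeAcc, hc]
    · have b1 : 2 ^ (d + 3) ≤ 2 ^ (K + 2) := Nat.pow_le_pow_right Nat.zero_lt_two (by omega)
      have b2 : υ.sc (ρ .cnt) ≤ 2 ^ (K + 2) := by
        rw [h7, ← pow_succ']; exact Nat.pow_le_pow_right Nat.zero_lt_two (by omega)
      exact r18.trans (max_le (h18.trans (max_le (le_max_left _ _) (le_max_right _ _)))
        (le_max_of_le_right (max_le (le_max_left _ _) (le_max_of_le_right (max_le b1 b2)))))
    · have e1 : 2 ^ (K - (d + 1)) * (50 * 2 ^ (d + 1)) = 50 * 2 ^ K := by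
        rw [Nat.mul_left_comm, ← pow_add, show K - (d + 1) + (d + 1) = K by omega]
      have e2 : 2 ^ K - 2 ^ (K - d) + 2 ^ (K - (d + 1)) = 2 ^ K - 2 ^ (K - (d + 1)) := by
        have : 2 ^ (K - d) ≤ 2 ^ K := Nat.pow_le_pow_right (by norm_num) (by omega)
        omega
      rw [treeCostD, show K - 1 - d = K - (d + 1) by omega, Nat.succ_mul]
      have := r19
      rw [Nat.mul_add, Nat.mul_add, e1] at this
      omega

/-- One leaf round. [folklore] -/
theorem leafBody_spec (σ : NState S V O) {v : ℕ} {rest : List ℕ} (hv : σ.vi (ν .vals) = v :: rest) (hone : σ.sc (ρ .one) = 1) :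
    let τ := (leafBody ρ ν ω : NCom S V O E).eval 𝓔 σ
    τ.vi (ν .vals) = rest ∧ τ.vo (ω .accN) = σ.vo (ω .accN) ++ leafBlock (σ.sc (ρ (.pm .n))) v ∧
      (∀ w, w ≠ ν .vals → τ.vi w = σ.vi w) ∧ (∀ p, p ≠ ω .accN → τ.vo p = σ.vo p) ∧
      (∀ r : PTreeS, r ≠ .pm .x → r ≠ .y → r ≠ .q → r ≠ .y2 → τ.sc (ρ r) = σ.sc (ρ r)) ∧ (∀ r, (∀ i, r ≠ ρ i) → τ.sc r = σ.sc r) ∧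
      τ.peak = σ.peak ∧ τ.steps = σ.steps + 5 := by
  intro τ
  have hτ : τ = (leafBody ρ ν ω : NCom S V O E).eval 𝓔 σ := rfl
  refine ⟨?_, ?_, fun w hw => ?_, fun p hp => ?_, fun r h1 h2 h3 h4 => ?_, fun r hr => ?_, ?_, ?_⟩
  · rw [hτ]; simp [leafBody, eval, hv]
  · rw [hτ]; simp [leafBody, eval, hv, hone, leafBlock]
  · rw [hτ]; simp [leafBody, eval, hw]
  · rw [hτ]; simp [leafBody, eval, hp]
  · rw [hτ]; simp [leafBody, eval, h1, h2, h3, h4]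
  · rw [hτ]; simp [leafBody, eval, hr]
  · rw [hτ]; simp [leafBody, eval]
  · rw [hτ]; simp [leafBody, eval]

/-- **The leaves loop**: after `i` rounds the first `i` values have become leaf blocks at the
back of the level accumulator. [folklore] -/
theorem leafBody_iterate (σ : NState S V O) (hone : σ.sc (ρ .one) = 1) :
    ∀ i, i ≤ (σ.vi (ν .vals)).length → let τ := ((leafBody ρ ν ω : NCom S V O E).eval 𝓔)^[i] σ
      τ.vi (ν .vals) = (σ.vi (ν .vals)).drop i ∧
        τ.vo (ω .accN) = σ.vo (ω .accN) ++ (((σ.vi (ν .vals)).take i).map (leafBlock (σ.sc (ρ (.pm .n))))).flatten ∧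
        (∀ w, w ≠ ν .vals → τ.vi w = σ.vi w) ∧ (∀ p, p ≠ ω .accN → τ.vo p = σ.vo p) ∧
        (∀ r : PTreeS, r ≠ .pm .x → r ≠ .y → r ≠ .q → r ≠ .y2 → τ.sc (ρ r) = σ.sc (ρ r)) ∧ (∀ r, (∀ i, r ≠ ρ i) → τ.sc r = σ.sc r) ∧
        τ.peak = σ.peak ∧ τ.steps = σ.steps + 5 * i
  | 0, _ => ⟨rfl, by simp, fun _ _ => rfl, fun _ _ => rfl, fun _ _ _ _ _ => rfl, fun _ _ => rfl, rfl, rfl⟩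
  | i + 1, hi => by
    obtain ⟨h1, h2, h3, h4, h5, h6, h7, h8⟩ := leafBody_iterate σ hone i (Nat.le_of_succ_le hi)
    intro τ
    set υ := ((leafBody ρ ν ω : NCom S V O E).eval 𝓔)^[i] σ with hυ
    have hτ : τ = (leafBody ρ ν ω : NCom S V O E).eval 𝓔 υ := Function.iterate_succ_apply' _ _ _
    have hne : (σ.vi (ν .vals)).drop i ≠ [] := by rw [Ne, List.drop_eq_nil_iff]; omega
    obtain ⟨v, rest, hvr⟩ : ∃ v rest, (σ.vi (ν .vals)).drop i = v :: rest := List.exists_cons_of_ne_nil hne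
    have hv : v = (σ.vi (ν .vals))[i]'(by omega) := by
      have := List.drop_eq_getElem_cons (l := σ.vi (ν .vals)) (i := i) (by omega)
      rw [this] at hvr; exact (List.cons.inj hvr).1.symm
    have hrest : rest = (σ.vi (ν .vals)).drop (i + 1) := by
      have := List.drop_eq_getElem_cons (l := σ.vi (ν .vals)) (i := i) (by omega)
      rw [this] at hvr; exact (List.cons.inj hvr).2.symm
    obtain ⟨r1, r2, r3, r4, r5, r6, r7, r8⟩ := leafBody_spec (𝓔 := 𝓔) ρ ν ω υ (h1.trans hvr) ((h5 .one (by simp) (by simp) (by simp) (by simp)).trans hone)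
    rw [h5 _ (by simp) (by simp) (by simp) (by simp)] at r2
    rw [hτ]
    refine ⟨r1.trans hrest, ?_, fun w hw => (r3 w hw).trans (h3 w hw), fun p hp => (r4 p hp).trans (h4 p hp),
      fun r a b c d => (r5 r a b c d).trans (h5 r a b c d), fun r hr => (r6 r hr).trans (h6 r hr), r7.trans h7, by rw [r8, h8]; ring⟩
    rw [r2, h2, List.append_assoc, List.take_succ_eq_append_getElem (by omega), List.map_append, List.flatten_append, hv]
    simp

/-- The working state entering the level loop (for `ptreeP_spec`). [folklore] -/
structure TreeStart (σ : NState S V O) (K : ℕ) (vals : List ℕ) : Prop where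
  inv : LevelInv ρ ν ω σ
  hlvl : σ.vi (ν .lvl) = blocksFrom (σ.sc (ρ (.pm .n))) vals 0 0 (2 ^ K)
  hcnt : σ.sc (ρ .cnt) = 2 ^ K
  hbl : σ.sc (ρ .bl) = 2
  htwo : σ.sc (ρ .two) = 2
  haccT : σ.vo (ω .accT) = []
  haccN : σ.vo (ω .accN) = []
  htree : σ.vi (ν .tree) = []

omit [DecidableEq S] [DecidableEq V] [DecidableEq O] in
/-- `ptreePre` has no extension calls. [folklore] -/
theorem ptreePre_noExt : (ptreePre ρ ν ω : NCom S V O E).noExt := by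
  simp [ptreePre, noExt, pow2P_noExt, moveN_noExt, emitK_noExt, leafBody]

/-- **The preparation of the tree.** [folklore] -/
theorem ptreePre_facts {vals : List ℕ} (σ : NState S V O) (hN : 1 < σ.sc (ρ (.pm .n))) (hodd : Odd (σ.sc (ρ (.pm .n))))
    (hvals : σ.vi (ν .vals) = vals) (hnv : σ.sc (ρ .nv) = vals.length) (hv1 : 1 ≤ vals.length) (hvN : ∀ v ∈ vals, v < σ.sc (ρ (.pm .n)))
    (hlvl : σ.vi (ν .lvl) = []) (htree : σ.vi (ν .tree) = []) (hA : σ.vi (ν (.pv .A)) = []) (hB : σ.vi (ν (.pv .B)) = [])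
    (hF : σ.vi (ν (.pv .F)) = []) (hG : σ.vi (ν (.pv .G)) = []) (hH : σ.vi (ν (.pv .H)) = []) (hC : σ.vi (ν (.pv .C)) = [])
    (hacc : σ.vo (ω .acc) = []) (haccN : σ.vo (ω .accN) = []) (haccT : σ.vo (ω .accT) = []) :
    let τ := (ptreePre ρ ν ω : NCom S V O E).eval 𝓔 σ
    ∃ K : ℕ, vals.length ≤ 2 ^ K ∧ 2 ^ K < 2 * vals.length ∧
      TreeStart ρ ν ω τ K (vals ++ List.replicate (2 ^ K - vals.length) 0) ∧
      τ.sc (ρ .K) = K ∧ τ.sc (ρ .P) = 2 ^ K ∧ τ.sc (ρ .nv) = vals.length ∧ τ.sc (ρ (.pm .n)) = σ.sc (ρ (.pm .n)) ∧ τ.sc (ρ .zero) = 0 ∧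
      τ.vi (ν .vals) = [] ∧ (∀ w, (∀ i, w ≠ ν i) → τ.vi w = σ.vi w) ∧ (∀ p, (∀ i, p ≠ ω i) → τ.vo p = σ.vo p) ∧
      (∀ r, (∀ i, r ≠ ρ i) → τ.sc r = σ.sc r) ∧
      τ.peak ≤ max σ.peak (2 ^ (K + 2)) ∧ τ.steps ≤ σ.steps + 25 * 2 ^ K + 30 := by
  intro τ
  set N := σ.sc (ρ (.pm .n)) with hNdef
  have hτ : τ = (ptreePre ρ ν ω : NCom S V O E).eval 𝓔 σ := rfl
  simp only [ptreePre, eval_seq] at hτ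
  -- A: constants
  set XA := ((setc (ρ .two) 2 : NCom S V O E)).eval 𝓔 (((setc (ρ .zero) 0 : NCom S V O E)).eval 𝓔 (((setc (ρ .one) 1 : NCom S V O E)).eval 𝓔 σ))
    with hXA
  have aone : XA.sc (ρ .one) = 1 := by simp [hXA, eval]
  have azero : XA.sc (ρ .zero) = 0 := by simp [hXA, eval]
  have atwo : XA.sc (ρ .two) = 2 := by simp [hXA, eval]
  have anv : XA.sc (ρ .nv) = vals.length := by simp [hXA, eval, hnv]
  have ar : ∀ r : PTreeS, r ≠ .one → r ≠ .zero → r ≠ .two → XA.sc (ρ r) = σ.sc (ρ r) := fun r h1 h2 h3 => by simp [hXA, eval, h1, h2, h3]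
  have ar' : ∀ r, (∀ i, r ≠ ρ i) → XA.sc r = σ.sc r := fun r hr => by simp [hXA, eval, hr]
  have avi : XA.vi = σ.vi := by simp [hXA, eval]
  have avo : XA.vo = σ.vo := by simp [hXA, eval]
  have apk : XA.peak = max σ.peak 2 := by simp [hXA, eval]
  have ast : XA.steps = σ.steps + 3 := by simp [hXA, eval]
  -- B: the padded count
  obtain ⟨⟨K, hK⟩, b2, b3, b4, b5, b6, b7, b8, b9⟩ := pow2P_spec 𝓔 (t := ρ .t) (role_ne ρ (show PTreeS.P ≠ .nv by decide))
    (role_ne ρ (show PTreeS.P ≠ .t by decide)) (role_ne ρ (show PTreeS.nv ≠ .t by decide)) XA (by rw [anv]; exact hv1)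
  set XB := (pow2P (ρ .P) (ρ .nv) (ρ .t) : NCom S V O E).eval 𝓔 XA with hXB
  rw [anv] at b2 b3 b8 b9
  rw [hK] at b2 b3
  have bnv : XB.sc (ρ .nv) = vals.length := (b5 _ (by simp) (by simp)).trans anv
  have bvals : XB.vi (ν .vals) = vals := by rw [b6, avi, hvals]
  -- C: values to the accumulator
  obtain ⟨c1, c2, c3, c4, c5, c6, c7⟩ := moveN_spec 𝓔 (ν .vals) (ω .acc) (ρ (.pm .x)) (ρ .nv) XB (by rw [bnv, bvals])
  set XC := (moveN (ν .vals) (ω .acc) (ρ (.pm .x)) (ρ .nv) : NCom S V O E).eval 𝓔 XB with hXC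
  rw [bnv, bvals] at c1 c2
  rw [List.drop_of_length_le le_rfl] at c1
  rw [List.take_of_length_le le_rfl, b7, avo, hacc, List.nil_append] at c2
  have cP : XC.sc (ρ .P) = 2 ^ K := (c3 _ (by simp)).trans hK
  have cnv : XC.sc (ρ .nv) = vals.length := (c3 _ (by simp)).trans bnv
  have cr : ∀ r : PTreeS, r ≠ .pm .x → r ≠ .P → r ≠ .t → XC.sc (ρ r) = XA.sc (ρ r) := fun r h1 h2 h3 => by
    rw [c3 _ (by simpa using h1), b5 _ (by simpa using h2) (by simpa using h3)]
  -- D, E, F: the padded values back in `vals`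
  set XD := ((sub (ρ .cnt) (ρ .P) (ρ .nv) : NCom S V O E)).eval 𝓔 XC with hXD
  obtain ⟨e1, e2, e3, e4, e5, e6⟩ := emitK_spec 𝓔 (ω .acc) (ρ .zero) (ρ .cnt) XD
  set XE := (emitK (ω .acc) (ρ .zero) (ρ .cnt) : NCom S V O E).eval 𝓔 XD with hXE
  have dcnt : XD.sc (ρ .cnt) = 2 ^ K - vals.length := by simp [hXD, eval, cP, cnv]
  have dzero : XD.sc (ρ .zero) = 0 := by
    have : XD.sc (ρ .zero) = XC.sc (ρ .zero) := by simp [hXD, eval]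
    rw [this, cr _ (by simp) (by simp) (by simp), azero]
  rw [dcnt, dzero, show XD.vo (ω .acc) = vals by simp [hXD, eval, c2]] at e1
  set vals' := vals ++ List.replicate (2 ^ K - vals.length) 0 with hvals'
  have hvl : vals'.length = 2 ^ K := by rw [hvals', List.length_append, List.length_replicate]; omega
  have hv'N : ∀ v ∈ vals', v < N := by
    intro v hv; rw [hvals', List.mem_append, List.mem_replicate] at hv
    rcases hv with hv | ⟨-, rfl⟩; exacts [hvN v hv, by omega]
  set XF := ((pour (ω .acc) (ν .vals) : NCom S V O E)).eval 𝓔 XE with hXF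
  have fvals : XF.vi (ν .vals) = vals' := by
    simp only [hXF, eval, NState.vi_bump, NState.vi_setVo, NState.vi_setVi, Function.update_self, e1, e3]
    rw [show XD.vi (ν .vals) = [] by simp [hXD, eval, c1], List.append_nil]
  have fP : XF.sc (ρ .P) = 2 ^ K := by simp [hXF, eval, e2, hXD, cP]
  have fone : XF.sc (ρ .one) = 1 := by
    simp only [hXF, eval, NState.sc_bump, NState.sc_setVo, NState.sc_setVi, e2]
    rw [show XD.sc (ρ .one) = XC.sc (ρ .one) by simp [hXD, eval], cr _ (by simp) (by simp) (by simp), aone]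
  have fn : XF.sc (ρ (.pm .n)) = N := by
    simp only [hXF, eval, NState.sc_bump, NState.sc_setVo, NState.sc_setVi, e2]
    rw [show XD.sc (ρ (.pm .n)) = XC.sc (ρ (.pm .n)) by simp [hXD, eval], cr _ (by simp) (by simp) (by simp),
      ar _ (by simp) (by simp) (by simp)]
  -- G: the leaves
  have hG := leafBody_iterate (𝓔 := 𝓔) ρ ν ω (XF.bump 0 (XF.sc (ρ .P) + 1)) (by simpa using fone) (2 ^ K)
    (by simp [fvals, hvl])
  obtain ⟨g1, g2, g3, g4, g5, g6, g7, g8⟩ := hG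
  simp only [NState.vi_bump, NState.vo_bump, NState.sc_bump, NState.peak_bump, NState.steps_bump, Nat.max_zero, fvals, fn, fP] at g1 g2 g3 g4 g5 g6 g7 g8
  rw [List.drop_of_length_le (by omega)] at g1
  rw [leaves_eq_blocksFrom hN hv'N (show 2 ^ K ≤ vals'.length by omega), show XF.vo (ω .accN) = [] by
    simp [hXF, eval, e4 _ (show ω .accN ≠ ω .acc by simp), hXD, c5 _ (show ω .accN ≠ ω .acc by simp), b7, avo, haccN],
    List.nil_append] at g2
  set XG := ((leafBody ρ ν ω : NCom S V O E).eval 𝓔)^[2 ^ K] (XF.bump 0 (2 ^ K + 1)) with hXG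
  have hloop : (times (ρ .P) (leafBody ρ ν ω) : NCom S V O E).eval 𝓔 XF = XG := by rw [eval_times, fP]
  rw [hloop] at hτ
  -- facts about `XF`
  have fw : ∀ w, w ≠ ν .vals → XF.vi w = σ.vi w := fun w hw => by
    simp only [hXF, eval, NState.vi_bump, NState.vi_setVo, NState.vi_setVi, Function.update_of_ne hw, e3]
    rw [show XD.vi w = XC.vi w by simp [hXD, eval], c4 w hw, b6, avi]
  have fvo : ∀ p, p ≠ ω .acc → XF.vo p = σ.vo p := fun p hp => by
    simp only [hXF, eval, NState.vo_bump, NState.vo_setVo, NState.vo_setVi, Function.update_of_ne hp, e4 p hp]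
    rw [show XD.vo p = XC.vo p by simp [hXD, eval], c5 p hp, b7, avo]
  have facc : XF.vo (ω .acc) = [] := by simp [hXF, eval]
  have fr : ∀ r : PTreeS, r ≠ .cnt → r ≠ .pm .x → r ≠ .P → r ≠ .t → r ≠ .one → r ≠ .zero → r ≠ .two → XF.sc (ρ r) = σ.sc (ρ r) := by
    intro r h1 h2 h3 h4 h5 h6 h7
    simp only [hXF, eval, NState.sc_bump, NState.sc_setVo, NState.sc_setVi, e2]
    rw [show XD.sc (ρ r) = XC.sc (ρ r) by simp [hXD, eval, h1], cr r h2 h3 h4, ar r h5 h6 h7]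
  have fr' : ∀ r, (∀ i, r ≠ ρ i) → XF.sc r = σ.sc r := fun r hr => by
    simp only [hXF, eval, NState.sc_bump, NState.sc_setVo, NState.sc_setVi, e2]
    rw [show XD.sc r = XC.sc r by simp [hXD, eval, hr], c3 r (hr _), b5 r (hr _) (hr _), ar' r hr]
  have fnv : XF.sc (ρ .nv) = vals.length := by
    simp only [hXF, eval, NState.sc_bump, NState.sc_setVo, NState.sc_setVi, e2]; rw [show XD.sc (ρ .nv) = XC.sc (ρ .nv) by simp [hXD, eval], cnv]
  have fzero : XF.sc (ρ .zero) = 0 := by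
    simp only [hXF, eval, NState.sc_bump, NState.sc_setVo, NState.sc_setVi, e2]; exact dzero
  have ftwo : XF.sc (ρ .two) = 2 := by
    simp only [hXF, eval, NState.sc_bump, NState.sc_setVo, NState.sc_setVi, e2]
    rw [show XD.sc (ρ .two) = XC.sc (ρ .two) by simp [hXD, eval], cr _ (by simp) (by simp) (by simp), atwo]
  have fpk : XF.peak ≤ max σ.peak (2 ^ (K + 2)) := by
    have e : XF.peak = XB.peak := by
      simp only [hXF, eval, NState.peak_bump, NState.peak_setVo, NState.peak_setVi, Nat.max_zero, e5]
      simp [hXD, eval, c6]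
    rw [e]
    refine b8.trans ?_
    rw [apk]
    have := Nat.one_le_two_pow (n := K)
    refine max_le (max_le (le_max_left _ _) (le_max_of_le_right ?_)) (le_max_of_le_right ?_) <;>
      rw [pow_succ, pow_succ] <;> omega
  have fst : XF.steps ≤ σ.steps + 9 * 2 ^ K + 12 := by
    have e : XF.steps = XD.steps + 2 * (2 ^ K - vals.length) + 1 + (vals'.length + 1) := by
      simp only [hXF, eval, NState.steps_bump, NState.steps_setVo, NState.steps_setVi, e1, e6, dcnt]
    have e' : XD.steps = XC.steps + 1 := by simp [hXD, eval]
    rw [e, e', c7, bnv, hvl]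
    have := b9; rw [ast] at this
    omega
  -- the last five instructions
  have glvl : XG.vi (ν .lvl) = [] := by rw [g3 _ (by simp), fw _ (by simp), hlvl]
  refine ⟨K, b2, b3, ⟨⟨?_, ?_, ?_, ?_, ?_, ?_, ?_, ?_, ?_, ?_⟩, ?_, ?_, ?_, ?_, ?_, ?_, ?_⟩, ?_, ?_, ?_, ?_, ?_, ?_, fun w hw => ?_,
    fun p hp => ?_, fun r hr => ?_, ?_, ?_⟩
  · rw [hτ]; simp [eval, g5 (.pm .n) (by simp) (by simp) (by simp) (by simp), fn]; exact hN
  · rw [hτ]; simp [eval, g5 (.pm .n) (by simp) (by simp) (by simp) (by simp), fn]; exact hodd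
  · rw [hτ]; simp [eval, g5 .one (by simp) (by simp) (by simp) (by simp), fone]
  · rw [hτ]; simp [eval, g3 (ν (.pv .F)) (by simp), fw (ν (.pv .F)) (by simp), hF]
  · rw [hτ]; simp [eval, g3 (ν (.pv .G)) (by simp), fw (ν (.pv .G)) (by simp), hG]
  · rw [hτ]; simp [eval, g3 (ν (.pv .H)) (by simp), fw (ν (.pv .H)) (by simp), hH]
  · rw [hτ]; simp [eval, g3 (ν (.pv .C)) (by simp), fw (ν (.pv .C)) (by simp), hC]
  · rw [hτ]; simp [eval, g3 (ν (.pv .A)) (by simp), fw (ν (.pv .A)) (by simp), hA]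
  · rw [hτ]; simp [eval, g3 (ν (.pv .B)) (by simp), fw (ν (.pv .B)) (by simp), hB]
  · rw [hτ]; simp [eval, g4 (ω .acc) (by simp), facc]
  · rw [hτ]; simp [eval, g2, glvl, g5 (.pm .n) (by simp) (by simp) (by simp) (by simp), fn, hvals']
  · rw [hτ]; simp [eval, g5 .P (by simp) (by simp) (by simp) (by simp), fP]
  · rw [hτ]; simp [eval]
  · rw [hτ]; simp [eval, g5 .two (by simp) (by simp) (by simp) (by simp), ftwo]
  · rw [hτ]; simp [eval, g4 (ω .accT) (by simp), fvo (ω .accT) (by simp), haccT]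
  · rw [hτ]; simp [eval]
  · rw [hτ]; simp [eval, g3 (ν .tree) (by simp), fw (ν .tree) (by simp), htree]
  · rw [hτ]; simp [eval, g5 .P (by simp) (by simp) (by simp) (by simp), g5 .one (by simp) (by simp) (by simp) (by simp), fP, fone, Nat.size_pow]
  · rw [hτ]; simp [eval, g5 .P (by simp) (by simp) (by simp) (by simp), fP]
  · rw [hτ]; simp [eval, g5 .nv (by simp) (by simp) (by simp) (by simp), fnv]
  · rw [hτ]; simp [eval, g5 (.pm .n) (by simp) (by simp) (by simp) (by simp), fn]
  · rw [hτ]; simp [eval, g5 .zero (by simp) (by simp) (by simp) (by simp), fzero]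
  · rw [hτ]; simp [eval, g1]
  · rw [hτ]; simp [eval, hw, g3 _ (hw _), fw _ (hw _)]
  · rw [hτ]; simp [eval, hp, g4 _ (hp _), fvo _ (hp _)]
  · rw [hτ]; simp [eval, hr, g6 r hr, fr' r hr]
  · rw [hτ]
    simp only [eval, NState.peak_bump, NState.peak_setSc, NState.peak_setVi, NState.peak_setVo, NState.sc_bump, NState.sc_setSc,
      NState.sc_setVi, NState.sc_setVo, Function.update_self, Nat.max_zero, g7]
    rw [Function.update_of_ne (by simp), Function.update_of_ne (by simp), g5 .P (by simp) (by simp) (by simp) (by simp), fP, Nat.size_pow]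
    have := Nat.one_le_two_pow (n := K)
    have hK1 : K + 1 ≤ 2 ^ (K + 2) := by
      have := Nat.lt_two_pow_self (n := K); rw [pow_succ, pow_succ]; omega
    refine max_le (max_le (fpk.trans le_rfl) (le_max_of_le_right ?_)) (le_max_of_le_right hK1)
    rw [pow_succ, pow_succ]; omega
  · rw [hτ]
    simp only [eval, NState.steps_bump, NState.steps_setSc, NState.steps_setVi, NState.steps_setVo, g8, g2, length_blocksFrom]
    rw [pow_zero]
    omega

omit [DecidableEq S] [DecidableEq V] [DecidableEq O] in
/-- `TreeStart` only depends on the registers. [folklore] -/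
theorem TreeStart.bump {σ : NState S V O} {K : ℕ} {vals : List ℕ} (h : TreeStart ρ ν ω σ K vals) (a k : ℕ) :
    TreeStart ρ ν ω (σ.bump a k) K vals :=
  ⟨h.inv.bump _ _ _ a k, h.hlvl, h.hcnt, h.hbl, h.htwo, h.haccT, h.haccN, h.htree⟩
set_option maxHeartbeats 400000 in -- buildfix (bf3-g27): 160k/180k FAIL, 200k PASS at accept time; line-neutral budget line
/-- **Specification of the product tree** (Harvey 2021, Lemma 2.3; von zur Gathen–Gerhard 2013,
Algorithm 10.3).  For `1 ≤ |vals|` reduced values and odd `N > 1`: with `K` the least exponent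
with `|vals| ≤ 2^K`, afterwards `tree = treeAcc N vals' K (K+1)` for the zero-padded values
`vals'` (every level of the subproduct tree, root first: block `i` of level `j` codes
`∏_{t<2^j} (X - vals'_{i 2^j + t})`), the registers `K, P = 2^K` hold the shape, every work queue
and accumulator is empty again; `peak ≤ max peak (max N 2^{K+2})`;
`steps ≤ steps + 300 (K+1) 2^K + treeCostD cost K K`. [folklore] -/
theorem ptreeP_spec {vals : List ℕ} (σ : NState S V O) (hN : 1 < σ.sc (ρ (.pm .n))) (hodd : Odd (σ.sc (ρ (.pm .n))))
    (hvals : σ.vi (ν .vals) = vals) (hnv : σ.sc (ρ .nv) = vals.length) (hv1 : 1 ≤ vals.length) (hvN : ∀ v ∈ vals, v < σ.sc (ρ (.pm .n)))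
    (hlvl : σ.vi (ν .lvl) = []) (htree : σ.vi (ν .tree) = []) (hA : σ.vi (ν (.pv .A)) = []) (hB : σ.vi (ν (.pv .B)) = [])
    (hF : σ.vi (ν (.pv .F)) = []) (hG : σ.vi (ν (.pv .G)) = []) (hH : σ.vi (ν (.pv .H)) = []) (hC : σ.vi (ν (.pv .C)) = [])
    (hacc : σ.vo (ω .acc) = []) (haccN : σ.vo (ω .accN) = []) (haccT : σ.vo (ω .accT) = []) :
    let τ := (ptreeP M ρ ν ω : NCom S V O E).eval 𝓔 σ
    ∃ K : ℕ, vals.length ≤ 2 ^ K ∧ 2 ^ K < 2 * vals.length ∧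
      τ.vi (ν .tree) = treeAcc (σ.sc (ρ (.pm .n))) (vals ++ List.replicate (2 ^ K - vals.length) 0) K (K + 1) ∧
      τ.sc (ρ .K) = K ∧ τ.sc (ρ .P) = 2 ^ K ∧ τ.sc (ρ .nv) = vals.length ∧ τ.sc (ρ (.pm .n)) = σ.sc (ρ (.pm .n)) ∧
      τ.vi (ν .lvl) = [] ∧ τ.vi (ν .vals) = [] ∧ τ.vi (ν (.pv .A)) = [] ∧ τ.vi (ν (.pv .B)) = [] ∧ τ.vi (ν (.pv .F)) = [] ∧
      τ.vi (ν (.pv .G)) = [] ∧ τ.vi (ν (.pv .H)) = [] ∧ τ.vi (ν (.pv .C)) = [] ∧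
      τ.vo (ω .acc) = [] ∧ τ.vo (ω .accN) = [] ∧ τ.vo (ω .accT) = [] ∧
      (∀ w, (∀ i, w ≠ ν i) → τ.vi w = σ.vi w) ∧ (∀ p, (∀ i, p ≠ ω i) → τ.vo p = σ.vo p) ∧ (∀ r, (∀ i, r ≠ ρ i) → τ.sc r = σ.sc r) ∧
      τ.peak ≤ max σ.peak (max (σ.sc (ρ (.pm .n))) (2 ^ (K + 2))) ∧
      τ.steps ≤ σ.steps + 300 * (K + 1) * 2 ^ K + treeCostD M.cost K K := by
  intro τ
  set N := σ.sc (ρ (.pm .n)) with hNdef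
  obtain ⟨K, hK1, hK2, hTS, xK, xP, xnv, xn, xzero, xvals, xw, xvo, xr, xpk, xst⟩ :=
    ptreePre_facts (𝓔 := 𝓔) ρ ν ω σ hN hodd hvals hnv hv1 hvN hlvl htree hA hB hF hG hH hC hacc haccN haccT
  set X := (ptreePre ρ ν ω : NCom S V O E).eval 𝓔 σ with hX
  set vals' := vals ++ List.replicate (2 ^ K - vals.length) 0 with hvals'
  refine ⟨K, hK1, hK2, ?_⟩
  -- the levels
  have hTS' := hTS.bump _ _ _ 0 (K + 1)
  obtain ⟨y1, y2, y3, y4, y5, y6, y7, y8, y9, y10, y11, y12, y13, y14, y15, y16, y17, y18, y19, -⟩ :=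
    levelP_iterate (𝓔 := 𝓔) M ρ ν ω (vals := vals') (K := K) (X.bump 0 (K + 1)) hTS'.inv hTS'.hlvl hTS'.hcnt hTS'.hbl hTS'.htwo
      hTS'.haccT hTS'.haccN hTS'.htree K le_rfl
  set Y := ((levelP M ρ ν ω : NCom S V O E).eval 𝓔)^[K] (X.bump 0 (K + 1)) with hY
  simp only [NState.sc_bump, NState.vi_bump, NState.vo_bump, NState.peak_bump, NState.steps_bump, Nat.max_zero, Nat.sub_self, pow_zero,
    xn, xK, xP, xnv, xzero, xvals] at y2 y3 y7 y9 y10 y11 y12 y13 y14 y15 y16 y17 y18 y19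
  have hτ : τ = ((moveN (ν .lvl) (ω .accT) (ρ (.pm .x)) (ρ .bl) ;ₙ pour (ω .accT) (ν .tree) : NCom S V O E)).eval 𝓔 Y := by
    show ((ptreePre ρ ν ω ;ₙ (times (ρ .K) (levelP M ρ ν ω) ;ₙ _) : NCom S V O E)).eval 𝓔 σ = _
    rw [eval_seq, eval_seq, eval_times, ← hX, xK]
  -- the root in front
  obtain ⟨m1, m2, m3, m4, m5, m6, m7⟩ := moveN_spec 𝓔 (ν .lvl) (ω .accT) (ρ (.pm .x)) (ρ .bl) Y (by rw [y6, y2, length_blocksFrom]; exact Nat.le_of_eq (Nat.one_mul _).symm)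
  rw [y6, y2] at m1 m2
  rw [← Nat.one_mul (2 ^ K + 1), ← length_blocksFrom (N := N) vals' K 0 1, List.drop_length] at m1
  rw [List.take_of_length_le (by rw [length_blocksFrom, Nat.one_mul]), y4, List.nil_append] at m2
  obtain ⟨yN, yodd, yone, yF, yG, yH, yC, yA, yB, yacc⟩ := y1
  simp only [hτ, eval_seq]
  refine ⟨?_, ?_, ?_, ?_, ?_, ?_, ?_, ?_, ?_, ?_, ?_, ?_, ?_, ?_, ?_, ?_, fun w hw => ?_, fun p hp => ?_, fun r hr => ?_, ?_, ?_⟩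
  · simp [eval, m2, m4 _ (show ν .tree ≠ ν .lvl by simp), y3, treeAcc]; rfl
  · simp [eval, m3 _ (show ρ .K ≠ ρ (.pm .x) by simp), y13]
  · simp [eval, m3 _ (show ρ .P ≠ ρ (.pm .x) by simp), y14]
  · simp [eval, m3 _ (show ρ .nv ≠ ρ (.pm .x) by simp), y15]
  · simp [eval, m3 _ (show ρ (.pm .n) ≠ ρ (.pm .x) by simp), y17]; rfl
  · simp [eval, m1]
  · simp [eval, m4 _ (show ν .vals ≠ ν .lvl by simp), y9]
  · simp [eval, m4 _ (show ν (.pv .A) ≠ ν .lvl by simp), yA]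
  · simp [eval, m4 _ (show ν (.pv .B) ≠ ν .lvl by simp), yB]
  · simp [eval, m4 _ (show ν (.pv .F) ≠ ν .lvl by simp), yF]
  · simp [eval, m4 _ (show ν (.pv .G) ≠ ν .lvl by simp), yG]
  · simp [eval, m4 _ (show ν (.pv .H) ≠ ν .lvl by simp), yH]
  · simp [eval, m4 _ (show ν (.pv .C) ≠ ν .lvl by simp), yC]
  · simp [eval, m5 _ (show ω .acc ≠ ω .accT by simp), yacc]
  · simp [eval, m5 _ (show ω .accN ≠ ω .accT by simp), y5]
  · simp [eval]
  · simp [eval, hw, m4 _ (hw .lvl), y10 w hw, xw w hw]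
  · simp [eval, hp, m5 _ (hp .accT), y11 p hp, xvo p hp]
  · simp [eval, m3 _ (hr (.pm .x)), y12 r hr, xr r hr]
  · simp only [eval, NState.peak_bump, NState.peak_setVi, NState.peak_setVo, Nat.max_zero, m6]
    exact y18.trans (max_le (xpk.trans (max_le (le_max_left _ _) (le_max_of_le_right (le_max_right _ _)))) (le_max_right _ _))
  · simp only [eval, NState.steps_bump, NState.steps_setVi, NState.steps_setVo, m7, m2, length_blocksFrom, y6]
    rw [Nat.one_mul]
    have hy := y19
    rw [Nat.mul_add] at hy
    have : 210 * (2 ^ K - 1) + (2 ^ K + 1) ≤ 212 * 2 ^ K := by have := Nat.one_le_two_pow (n := K); omega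
    nlinarith [hy, xst, this, Nat.zero_le (K * 2 ^ K)]

/-- **`ptreeP` meets the multiplier's precondition at every call.** [folklore] -/
theorem ptreeP_extOK {vals : List ℕ} (σ : NState S V O) (hN : 1 < σ.sc (ρ (.pm .n))) (hodd : Odd (σ.sc (ρ (.pm .n))))
    (hvals : σ.vi (ν .vals) = vals) (hnv : σ.sc (ρ .nv) = vals.length) (hv1 : 1 ≤ vals.length) (hvN : ∀ v ∈ vals, v < σ.sc (ρ (.pm .n)))
    (hlvl : σ.vi (ν .lvl) = []) (htree : σ.vi (ν .tree) = []) (hA : σ.vi (ν (.pv .A)) = []) (hB : σ.vi (ν (.pv .B)) = [])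
    (hF : σ.vi (ν (.pv .F)) = []) (hG : σ.vi (ν (.pv .G)) = []) (hH : σ.vi (ν (.pv .H)) = []) (hC : σ.vi (ν (.pv .C)) = [])
    (hacc : σ.vo (ω .acc) = []) (haccN : σ.vo (ω .accN) = []) (haccT : σ.vo (ω .accT) = []) :
    (ptreeP M ρ ν ω : NCom S V O E).extOK 𝓔 σ := by
  obtain ⟨K, -, -, hTS, xK, -⟩ :=
    ptreePre_facts (𝓔 := 𝓔) ρ ν ω σ hN hodd hvals hnv hv1 hvN hlvl htree hA hB hF hG hH hC hacc haccN haccT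
  refine ⟨extOK_of_noExt 𝓔 (ptreePre_noExt ρ ν ω) σ, ?_, extOK_of_noExt 𝓔 (moveN_noExt _ _ _ _) _, trivial⟩
  rw [extOK_times]
  intro d hd
  rw [xK] at hd ⊢
  have hTS' := hTS.bump _ _ _ 0 (K + 1)
  exact (levelP_iterate (𝓔 := 𝓔) M ρ ν ω (K := K) _ hTS'.inv hTS'.hlvl hTS'.hcnt hTS'.hbl hTS'.htwo hTS'.haccT hTS'.haccN hTS'.htree
    d hd.le).2.2.2.2.2.2.2.2.2.2.2.2.2.2.2.2.2.2.2 hd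

end PTree

end NCom

end Literature.Computability.Complexity
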